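import Literature.MathematicalPhysics.QuantumFieldTheory.Balaban1983to89.B4Delta112ZeroBoxHolder
import Literature.MathematicalPhysics.QuantumFieldTheory.Balaban1983to89.B4Ineq19ZeroBoxEta

/-!
# `Balaban1983to89.B4Ineq111ZeroNestEta` — B4 «Theorem (Proposition 2.1 of [1])», the `δG` clauses (1.11)–(1.12) IN
# THE CELL'S TYPED FORM `B4.Ineq111_112`, PROVED at `A = 0` on the ZERO-FIELD NESTED-BOX FAMILY (every scale `k ≥ 1`,
# every nested pair of boxes `Ω ⊂ Ω₀`, every mass `m² ∈ [0, m²₊]`), TOGETHER WITH (1.9)–(1.10) `B4.Ineq19_110` on the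
# same family with ONE pair of constants; hence the typed leaf `B4.ThmPrinted` restricted to `0 ≤ α < 1`
# (`ThmPrintedNN`, BOTH conjuncts) HOLDS on that family

**Source.** T. Bałaban, *Regularity and Decay of Lattice Green's Functions*, Commun. Math. Phys. **89**, 571–597 (1983)
(bib key `Balaban1983RegularityDecay`, «B4» of the 1983–89 series): p. 572 [PDF 2] (1.1)–(1.6), p. 573 [PDF 3] the
Theorem with (1.9)–(1.12) and its last sentence on rectangular parallelepipeds (journal page = PDF page + 570; renders
`b2b-balaban-ref1/pages/1983-cmp89-regularity-decay/1983-cmp89-regularity-decay-p002-x2.png`, `-p003-x2.png`, read as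
images; cell transcript `b2b-balaban-b04/transcript-B4.md`).  A new leaf on top of `B4Delta112ZeroBoxHolder` (pv17
node 11: the Hölder clause (1.9)·(1.12) for `δG_k(Ω,Ω₀,0)` on nested boxes, `delta112_zero_box_holder_coeff`; through it
`B4Delta112ZeroBox` node 9: the value and derivative clauses (1.10)·(1.12), `delta112_zero_box_value_coeff`,
`delta112_zero_box_deriv_coeff`) and of `B4Ineq19ZeroBoxEta` (pv17 node 12: b04's concrete zero-field carrier read in the
printed BOND convention `zeroFieldSettingBond`, the box family `boxFam`, and the typed (1.9)–(1.10) on it,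
`ineq19_110_boxFam`); b04's `B4Cor23ZeroEta` / `B4Cor23ZeroDelta` (the carrier `ZeroFieldInstance`, `zeroFieldSettingB`,
`δG = B4Cor23ZeroDelta.dG`, `bdist`) are USED READ-ONLY.  The typed statements `B4.Ineq19_110`, `B4.Ineq111_112`,
`B4.ThmPrinted` are the cell's (`B4.lean`, b04) and are USED BY NAME, never restated.  No existing module is touched;
nothing of B4 is asserted as a fact.

## WHAT IS PRINTED (verbatim; `≦` of the print written `≤`)

p. 572: «G_k(Ω, A) = (−Δ^{η,N}_{A,Ω} + m² + aP_k(A))^{−1},   (1.6)  where m² ≥ 0 and a is a positive constant close to 1.»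

p. 573: «**Theorem** (Proposition 2.1 of [1]). For α < 1 there exist positive constants δ₀, c₀, R₀ independent of
A, k, Ω and depending on d, M only, c₀ on α also, such that for e sufficiently small and for an arbitrary function
f : Ω → R^N, we have
|x − x′|^{−α} |U(A(Γ_{x,x′}))(D^η_{A,μ}G_k(Ω, A)f)(x′) − (D^η_{A,μ}G_k(Ω, A)f)(x)| ≤ c₀ exp(−δ₀ dist({x, x′}, supp f))‖f‖_∞   (1.9)
for x, x′ ∈ Ω, and satisfying the condition dist({x, x′}, Ω^c) ≥ R₀. Similarly
|(D^η_{A,μ}G_k(Ω, A)f)(x)|, |(G_k(Ω, A)(x)| ≤ c₀ exp(−δ₀ dist(x, supp f))‖f‖_∞   (1.10)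
for x ∈ Ω, dist(x, Ω^c) ≥ R₀.» ⟦sic: «(G_k(Ω, A)(x)» — read `(G_k(Ω, A)f)(x)`⟧ «If Ω ⊂ Ω₀, then for δG_k(Ω, Ω₀, A)
defined by the equality
δG_k(Ω, Ω₀, A) = G_k(Ω, A) − G_k(Ω₀, A),   (1.11)
we have the inequalities (1.5) and (1.6)» ⟦sic: (1.9) and (1.10) are meant; (1.5), (1.6) are definitions⟧ «(with the
same restrictions on x, x′) with the additional factor
exp(−δ₀ dist(supp f, Ω^c) − δ₀ dist(supp f, Ω^c))   (1.12)
on the right hand sides.» ⟦sic: the same distance printed twice; the cell types one distance for the evaluation points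
and one for the source support, `B4.Ineq111_112` docstring, DIVERGENCE D-b04.2⟧ «For some simple sets Ω, e.g. for
rectangular parallelepipeds, the inequalities hold without any restrictions on the points x, x′, i.e. for all x, x′ ∈ Ω.»

## WHAT THIS FILE CERTIFIES (kernel-checked, zero `sorry`, no hypotheses; the lineage and b04's carrier are USED BY NAME)

Fix a dimension `d + 1`, `L = ℓ + 1 ≥ 2`, the coefficient `a > 0` of `aP_k` in (1.6), a mass ceiling `m²₊`, a big-block
size `Mb` (enters only the typed antecedent `bigBlocks`) and an ADMISSIBLE boundary assignment `g` (b04's hypothesis of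
`cor23Printed_zeroFieldB`: `g i f ≤ dist_η(supp f, Ω₀∖Ω) = B4Cor23ZeroDelta.bdist` whenever `Ω₀∖Ω` and `supp f` are
non-empty; the default `g = bdist` of b04's `zeroFieldSetting` is admissible, `bdist_admissible`).  The ZERO-FIELD
NESTED-BOX FAMILY `nestFam ℓ m²₊ a Mb g : NestInst d ℓ m²₊ → EtaSetting` (§3) has one member per scale `k ≥ 1` (mesh
`η = L^{-k}`), NESTED PAIR of boxes of unit blocks `Ω = Π_μ[0, M_μ) ⊂ Ω₀ = Π_μ[−s_μ, M₀_μ − s_μ)` (`B4TwoBox120.Fits M M₀ s`,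
`M_μ ≥ 1`), mass `m² ∈ [0, m²₊]` and charge `e`; the member is b04's `ZeroFieldInstance`
`⟨L^k, boxDom(L^k·M), shiftBox L^k M₀ s, m², e⟩` read by node 12's `zeroFieldSettingBond` (= b04's `zeroFieldSettingB` with
the two Hölder fields in the bond convention): `nestFam … i = boxFam … i.toBox = zeroFieldSettingBond a Mb g i.toZF`
(`nestFam_eq`).
* `ineq111_112_nestFam` (§6) — **THE CELL'S TYPED (1.11)–(1.12) `B4.Ineq111_112` AT `A = 0` ON EVERY NESTED PAIR OF
  BOXES AT EVERY SCALE**: for every `0 ≤ α < 1` there are `δ₀ > 0`, `c₀ > 0` (depending on `d, ℓ, a, m²₊, α`;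
  «independent of A, k, Ω») with `∀ R₀ i, Ineq111_112 (nestFam ℓ m²₊ a Mb g i) α δ₀ c₀ R₀` — i.e.
  (`ineq111_112_bond_iff`, by `Iff.rfl`) for every member, direction `μ`, source `f` and points `x, x′` of `Ω`, with
  `δG = δG_k(Ω,Ω₀,0)`:
  `|x − x′|_η^{−α}|(D_μδG f)(x′) − (D_μδG f)(x)| ≤ c₀e^{−δ₀dist_η({x,x′},supp f)}e^{−(δ₀dist_η({x,x′},Ω₀∖Ω) + δ₀g(f))}‖f‖_∞`
  on pairs of bonds of `Ω`, `|(D_μδG f)(x)| ≤ c₀e^{−δ₀dist_η(x,supp f)}e^{−(δ₀dist_η(x,Ω₀∖Ω) + δ₀g(f))}‖f‖_∞` and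
  `|(δG f)(x)| ≤ (the same)`, with NO restriction on the points (the typed antecedent `rect ∨ R₀ ≤ …` is not used;
  `rect` holds anyway, `nestFam_rect`); `ineq111_112_nestFam_mono`: the same for every `0 < δ ≤ δ₀`, `c ≥ c₀`;
* `dlhs19_bound`, `dvalDG_bound`, `dvalG_bound` (§5) — the three clauses separately, each from the corresponding lineage
  theorem (nodes 11, 9, 9) through §2 and the dictionary lemmas of §4;
* `dG_eq` / `NestInst.dG_eq` (§2–§3) — **b04's `δG_k(Ω,Ω₀,0)` OF THE MEMBER IS THE LINEAGE'S `δG` OF THE NESTED PAIR**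
  (`B4Cor23ZeroDelta.dG L^k a m² hsub f x = B4Delta112ZeroBox.dG L^k a m² (Fits M M₀ s) f x`), from the TRANSLATION
  COVARIANCE of the operator (1.6) at `A = 0` (`fineOpR_shiftBox`: `fineOpR` of the translated outer box at translated
  points is `boxOpR L^k a m² M₀`; `green_shift_mulVec`: hence so is its inverse) — the only new mathematics of the file;
  `nestFam_dvalG`, `nestFam_dvalDG`, `nestFam_dlhs19`: the carrier's three `δG` fields of a member, rewritten;
* `ineq19_110_nestFam` (§6) — the typed (1.9)–(1.10) on the family (each member IS a member of node 12's box family with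
  `Ω₀ :=` the translated outer box, so this is `ineq19_110_boxFam`), and `thm_nestFam` — **BOTH CONJUNCTS
  `Ineq19_110 ∧ Ineq111_112` WITH ONE PAIR OF CONSTANTS** (`min`/`max` of the two pairs, by the monotonicity
  `ineq19_110_weaken` / `ineq111_112_nestFam_mono`);
* `ThmPrintedNN` (§7) := the typed leaf `B4.ThmPrinted` VERBATIM (both conjuncts, its quantifier shape) with the one
  added binder `0 ≤ α` (`thmPrintedNN_of_thmPrinted`: the leaf implies it; `thmPrinted19NN_of_thmPrintedNN`: it implies
  node 12's half), and `thmPrintedNN_nestFam` / `thmPrintedNN_nestFam_std` — **IT HOLDS ON THE NESTED-BOX FAMILY** (any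
  admissible `g`, resp. the default `g = bdist`), with `R₀ = e₁ = 1` and the antecedents `regular`, `bigBlocks`,
  `0 < e ≤ e₁` unused;
* `ineq112_nestFamB` (§6) — the two (1.10)·(1.12) clauses hold VERBATIM in b04's own carrier `zeroFieldSettingB`
  (identical fields; `ineq112_B_of_bond`); with node 12's `ineq110_boxFamB` the verbatim carrier thus has all four
  non-Hölder clauses of the Theorem at `A = 0` on (nested) boxes;
* §8: NON-VACUITY — for every `e₁ > 0`, every `Mb ≥ 1` and EVERY scale `k ≥ 1` a GENUINELY nested member (`Ω` = one big
  block `[0,Mb)^{d+1}`, `Ω₀ = [−Mb, 2Mb)^{d+1}`, mass `0`, charge `e₁`; `Ω₀∖Ω ≠ ∅`, `nested_outR_nonempty`) meets all four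
  typed antecedents (`nested_hypotheses`: both `Ω` and the translated `Ω₀` are unions of `Mb·L^k`-blocks), so the
  threshold «for e sufficiently small» excludes no mesh; the index type is inhabited and the statements are instantiated
  at `d + 1 = 4`, `L = 2`, `a = 1`, `m²₊ = 1`, `Mb = 5`, `α = 1/2`.

## DICTIONARY (typist's; each line is a reading, not a quotation; everything at `A = 0`, `U ≡ 1`, one component; the
dictionaries of `B4Cor23ZeroEta` / `B4Cor23ZeroDelta` (carrier, `δG`), `B4Ineq19ZeroBoxEta` (bond convention) and
`B4Delta112ZeroBox[Holder]` (nested-box theorems) apply)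

* `Ω ⊂ Ω₀`, both rectangular parallelepipeds of unit blocks at mesh `η = L^{-k}` ↦ inner fine point set
  `R = B4Reflection242.boxDom (L^k·M) = Π_μ[0, L^kM_μ) ∩ ℤ^{d+1}` AT THE ORIGIN and outer set
  `R₀ = shiftBox L^k M₀ s = Π_μ[−L^ks_μ, L^k(M₀_μ − s_μ)) ∩ ℤ^{d+1}` (§1; `Fits M M₀ s`: `s_μ ≥ 0`, `s_μ + M_μ ≤ M₀_μ`), `n = L^k`.
  The lineage (`B4Delta112ZeroBox`) places `Ω₀ = Π[0,M₀)` at the origin and `Ω = s + Π[0,M)`; the two placements differ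
  by the lattice translation `y ↦ y − L^ks` (`shiftEquiv`), under which the operator (1.6) at `A = 0` — Neumann
  Laplacian of the region, mass, and the block-averaging kernel of `aP_k(0)` (blocks `blk L^k`, `blk_sub_mul`) — is
  covariant (`neumannLapR_shift`, `fineOpR_shiftBox`).  b04's carrier fixes no origin (any finsets `R ⊆ R₀`), so both
  placements are instances; this file's member puts `Ω` at the origin because node 12's box family does.
* `δG_k(Ω,Ω₀,0)f` for `f : Ω → ℝ` ↦ b04's `B4Cor23ZeroDelta.dG n a m² hsub f = G_k(Ω,0)f − (G_k(Ω₀,0)f̃)|_Ω` with `f̃` the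
  extension of `f` by zero to `Ω₀` (`extTo`; b04's reading of (1.11) applied to `f : Ω → R^N`) ↦ (`dG_eq`) the lineage's
  `B4Delta112ZeroBox.dG L^k a m² (Fits M M₀ s) f = (boxOpR M)⁻¹f − ((boxOpR M₀)⁻¹(Ef))(· + L^ks)`.
* `D^η_{0,μ}`, the left sides of (1.9)/(1.10), `dist(·, supp f)`, `‖f‖_∞`, `|x − x′|_η^{−α}` ↦ as in `B4Ineq19ZeroBoxEta`
  (`fdiff`, `holderQ` — bond convention —, `setDist (edistR n R)`, `supN`, `edistR_rpow_neg`).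
* the factor (1.12) ↦ the typed `exp(−(δ₀·bdist2 x x′ + δ₀·bdistS f))` (resp. `bdist1 x`) of `B4.Ineq111_112` with b04's
  fields `bdist2 x x′ = dist_η({x,x′}, Ω₀∖Ω) = setDist (edistR n R₀) {x,x′} (outR R R₀)`, `bdist1 x = dist_η(x, Ω₀∖Ω)` and
  `bdistS f = g i f` (admissible; default `dist_η(supp f, Ω₀∖Ω)`).  Since `Ω₀∖Ω ⊆ Ω^c`, these typed distances are `≥` the
  printed `dist(·, Ω^c)`, so the typed right side is `≤` the printed one: the CERTIFIED typed form is the stronger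
  reading (b04's, `B4Cor23ZeroEta` admissible-`g` note), and the printed form follows from it.
* the lineage's hypotheses `hDb : D_b ≤ |(x + L^ks) − y|_∞`, `hDf : D_f ≤ |(z + L^ks) − y|_∞` over outer fine points `y`
  off the inner box and `z ∈ supp f` ↦ `Db1_le`/`Db2_le` with `D_b = L^k·bdist`, and `Df_le` with `D_f = L^k·max(g(f), 0)`
  (§4; a negative `g i f` only weakens the bound, `transfer12`).
* «δ₀, c₀, R₀ independent of A, k, Ω and depending on d, M only, c₀ on α also […] for e sufficiently small» ↦ the typed
  leaf's `∀ α, … → ∃ δ₀ c₀ R₀ e₁ > 0, ∀ i, antecedents → …`; here `δ₀, c₀` depend on `d, ℓ, a, m²₊` and BOTH on `α`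
  (inherited from nodes 10–11), uniform in the member (`k`, `M`, `M₀`, `s`, `m²`, `e`); `R₀`, `e₁` are free.
* `0 ≤ α < 1` ↦ the binders `(hα0 : 0 ≤ α) (hα1 : α < 1)` (`B4Ineq19ZeroBoxEta`, OBSERVATION (O-α)).

## OBSERVATIONS (analysis-level; NOT kernel-certified; for b04 / the carver) — those of `B4Ineq19ZeroBoxEta` apply verbatim:
(O-α) the literal leaf's `α < 0` instances fail on any faithful family with boxes of unbounded diameter, hence `0 ≤ α`;
(O-bond) b04's UNGUARDED Hölder field `dlhs19` pairs, at a face of `Ω` interior to `Ω₀`, a genuine derivative of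
`G_k(Ω₀,0)f̃` with an artificial `0` at weight `η^{−α} → ∞`, so the typed (1.11) with that field fails on nested boxes for
`α > 0` while the printed bond-convention statement (certified here through `holderQ`) is not in doubt.  Consequently
this file certifies `Ineq111_112` for the bond-convention carrier and, for b04's verbatim carrier, the two non-Hölder
clauses only (`ineq112_nestFamB`).

## HONEST SCOPE — what is NOT certified here

(i) Only `A = 0` (`U ≡ 1`, `regular` void, the charge inert), one component.  (ii) Only NESTED BOXES: `Ω = Π_μ[0, M_μ)` of
unit blocks at the origin inside a box `Ω₀` of unit blocks (the `rect` branch of the typed antecedent); general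
big-block unions `Ω ⊂ Ω₀` with the restrictions `dist(·, Ω^c) ≥ R₀` (the print's random-walk expansion (2.13),
(2.18)–(2.22)) are NOT treated, nor is a non-box `Ω₀` around a box `Ω`.  (iii) `0 ≤ α < 1`: the literal leaf
`B4.ThmPrinted` (`∀ α < 1`) is NOT discharged — by (O-α) it cannot be on this family — `ThmPrintedNN` is.  (iv) Hölder
fields in the bond convention (node 12's carrier); see (O-bond).  (v) Mesh `η = L^{-k}`, `k ≥ 1`, `L ≥ 2`.  (vi) Constants
existential, depending on `d, ℓ, a, m²₊, α`; distances are `η`-scaled sup-distances (Euclidean `≥` sup, so the printed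
Euclidean form follows with `δ₀/√(d+1)`); `‖f‖_∞` over the fine points of `Ω`.  (vii) ROUTE: pure plumbing — translation
covariance of (1.6) at `A = 0` (§2) plus the lineage theorems of nodes 9, 11, 12 (print's box route pp. 582–584 and the
`δG` representation p. 579, kernel-proved there) instantiated on the member and transported through §4; no new analysis.
(viii) This file does not touch `B4.lean`, `B4Cor23ZeroEta.lean`, `B4Cor23ZeroDelta.lean` (b04's), `DagBinding` /
`DagDischarged` (the carver's); whether the binding's leaf is re-typed (`0 ≤ α`, bond convention) so that
`thmPrintedNN_nestFam` discharges it is b04's / the carver's call — this file offers `ThmPrintedNN`, the family and the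
proofs.

**Value = kernel certificate (the cell's typed (1.9)–(1.12) at `A = 0` on the zero-field nested-box family, all scales,
all `0 ≤ α < 1`, one pair of constants, bound to b04's concrete carrier), NOT summit progress**: the Yang–Mills /
`Summit.QuantumFields` statements are untouched; no Literature fact is minted — every hypothesis used is kernel-proved in
this package.
-/

namespace Literature.MathematicalPhysics.QuantumFieldTheory.Balaban1983to89.B4Ineq111ZeroNestEta

open Finset Matrix
open Literature.MathematicalPhysics.QuantumFieldTheory.Balaban1983to89.B4 (EtaSetting Ineq19_110 Ineq111_112
  ThmPrinted)
open Literature.MathematicalPhysics.QuantumFieldTheory.Balaban1983to89.B4ContourShift (supNorm supNorm_nonneg)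
open Literature.MathematicalPhysics.QuantumFieldTheory.Balaban1983to89.B4Reflection242 (boxDom mem_boxDom blk diagK
  avgK nbrs)
open Literature.MathematicalPhysics.QuantumFieldTheory.Balaban1983to89.B4BoxCov237 (boxOpR uvec)
open Literature.MathematicalPhysics.QuantumFieldTheory.Balaban1983to89.B4Lower18 (fineOpR fineOpR_boxDom
  IsBlockUnion boxDom_isBlockUnion edistR neumannLapR regionOpR)
open Literature.MathematicalPhysics.QuantumFieldTheory.Balaban1983to89.B4TwoBox120 (Fits Fits.scale emb emb_val
  add_mem_boxDom blk_add_mul mem_nbrs_add_iff)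
open Literature.MathematicalPhysics.QuantumFieldTheory.Balaban1983to89.B4Cor23Zero (fdiff fdiff_of_mem
  fdiff_of_not_mem supp extR edistR_nonneg)
open Literature.MathematicalPhysics.QuantumFieldTheory.Balaban1983to89.B4Cor23ZeroDelta (setDist setDist_le
  mem_supp outR mem_outR incl extTo resTo bdist bdist_le)
open Literature.MathematicalPhysics.QuantumFieldTheory.Balaban1983to89.B4Cor23ZeroEta (ZeroFieldInstance
  zeroFieldSettingB zeroFieldSetting)
open Literature.MathematicalPhysics.QuantumFieldTheory.Balaban1983to89.B4Delta112ZeroBox (ext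
  delta112_zero_box_value_coeff delta112_zero_box_deriv_coeff)
open Literature.MathematicalPhysics.QuantumFieldTheory.Balaban1983to89.B4Delta112ZeroBoxHolder
  (delta112_zero_box_holder_coeff)
open Literature.MathematicalPhysics.QuantumFieldTheory.Balaban1983to89.B4Ineq19ZeroBoxEta (holderQ holderQ_of_bond
  holderQ_of_not_bond zeroFieldSettingBond zeroFieldSettingBondStd ineq19_110_bond_iff abs_le_supN supN_nonneg BoxInst
  boxFam boxFamB ineq19_110_boxFam Lk_pos D1_le D2_le exp_arg setDist_edistR_nonneg nbr nbr_val fdiff_eq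
  edistR_rpow_neg ThmPrinted19NN thmPrinted19NN_of_thmPrinted)

noncomputable section

variable {d : ℕ}

/-! ## §1 The outer box translated by `−n·s`: `Ω₀ = Π_μ[−s_μ, M₀_μ − s_μ) ⊇ Ω = Π_μ[0, M_μ)` on fine points -/

/-- **THE TRANSLATED OUTER FINE BOX** `{y : y + n·s ∈ Π_μ[0, nM₀_μ)} = Π_μ[−ns_μ, n(M₀_μ − s_μ))` (lattice units): the
fine points of `Ω₀` when the INNER box `Ω = Π_μ[0, M_μ)` is placed at the origin and `Ω ⊂ Ω₀` is the nested pair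
`B4TwoBox120.Fits M M₀ s` (`s + Π[0,M) ⊂ Π[0,M₀)`) translated by `−s`. [folklore] -/
def shiftBox (n : ℕ) (M0 : Fin (d + 1) → ℕ) (s : Fin (d + 1) → ℤ) : Finset (Fin (d + 1) → ℤ) :=
  (boxDom (fun i => n * M0 i)).image fun y => y - fun i => (n : ℤ) * s i

/-- membership: `y ∈ shiftBox ↔ y + n·s ∈ Π[0, nM₀)`. [folklore] -/
theorem mem_shiftBox {n : ℕ} {M0 : Fin (d + 1) → ℕ} {s : Fin (d + 1) → ℤ} {y : Fin (d + 1) → ℤ} :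
    y ∈ shiftBox n M0 s ↔ (y + fun i => (n : ℤ) * s i) ∈ boxDom (fun i => n * M0 i) := by
  constructor
  · intro h
    obtain ⟨z, hz, rfl⟩ := Finset.mem_image.1 h
    simpa using hz
  · intro h
    exact Finset.mem_image.2 ⟨_, h, by simp⟩

/-- the inner fine box lies in the translated outer one (`Ω ⊂ Ω₀`). [folklore] -/
theorem box_subset_shiftBox {n : ℕ} {M M0 : Fin (d + 1) → ℕ} {s : Fin (d + 1) → ℤ} (hs : Fits M M0 s) :
    boxDom (fun i => n * M i) ⊆ shiftBox n M0 s := by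
  intro x hx
  rw [mem_shiftBox]
  exact add_mem_boxDom (hs.scale n) hx

/-- a fine box whose sides are multiples of `b` is a union of `b`-blocks. [folklore] -/
theorem boxDom_isBlockUnion_of_dvd {b : ℕ} (hb : 1 ≤ b) {N : Fin (d + 1) → ℕ} (hN : ∀ i, b ∣ N i) :
    IsBlockUnion b (boxDom N) := by
  have e : N = fun i => b * (N i / b) := funext fun i => (Nat.mul_div_cancel' (hN i)).symm
  rw [e]
  exact boxDom_isBlockUnion hb _

/-- the translated outer box is a union of `b`-blocks when its sides and the translation are multiples of `b`
(used with `b = n`: a union of unit blocks; and with `b = Mb·n`: the typed big-block antecedent). [folklore] -/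
theorem shiftBox_isBlockUnion_of_dvd {n b : ℕ} (hb : 1 ≤ b) {M0 : Fin (d + 1) → ℕ} {s : Fin (d + 1) → ℤ}
    (hM0 : ∀ i, b ∣ n * M0 i) (hsd : ∀ i, (b : ℤ) ∣ (n : ℤ) * s i) : IsBlockUnion b (shiftBox n M0 s) := by
  have hbox := boxDom_isBlockUnion_of_dvd (d := d) hb hM0
  have et : (fun i => (n : ℤ) * s i) = fun i => (b : ℤ) * (fun j => (n : ℤ) * s j / b) i :=
    funext fun i => (Int.mul_ediv_cancel' (hsd i)).symm
  intro x hx z hz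
  rw [mem_shiftBox] at hx ⊢
  refine hbox hx ?_
  rw [et, blk_add_mul hb, blk_add_mul hb, hz]

/-- in particular it is a union of `n`-blocks (unit blocks of `Ω₀`). [folklore] -/
theorem shiftBox_isBlockUnion {n : ℕ} (hn : 1 ≤ n) (M0 : Fin (d + 1) → ℕ) (s : Fin (d + 1) → ℤ) :
    IsBlockUnion n (shiftBox n M0 s) :=
  shiftBox_isBlockUnion_of_dvd hn (fun _ => Dvd.intro _ rfl) (fun _ => Dvd.intro _ rfl)

/-- block labels translate: `blk n (x − n·s) = blk n x − s`. [folklore] -/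
theorem blk_sub_mul {n : ℕ} (hn : 1 ≤ n) (x s : Fin (d + 1) → ℤ) :
    blk n (x - fun i => (n : ℤ) * s i) = blk n x - s := by
  have h := blk_add_mul hn x (-s)
  have e : (x + fun i => (n : ℤ) * (-s) i) = x - fun i => (n : ℤ) * s i := by
    funext i; simp [sub_eq_add_neg]
  rw [e] at h
  rw [h]
  funext i; simp [sub_eq_add_neg]

/-- **THE TRANSLATION** `y ↦ y − n·s` from the outer fine box at the origin (the coordinates of the lineage's
`B4Delta112ZeroBox`, where `Ω₀ = Π[0,M₀)` and `Ω = s + Π[0,M)`) onto the translated outer box (the coordinates of this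
file, where `Ω = Π[0,M)` and `Ω₀ = −s + Π[0,M₀)`), a bijection of fine points. [folklore] -/
def shiftEquiv (n : ℕ) (M0 : Fin (d + 1) → ℕ) (s : Fin (d + 1) → ℤ) :
    ↥(boxDom (fun i => n * M0 i)) ≃ ↥(shiftBox n M0 s) where
  toFun y := ⟨y.1 - fun i => (n : ℤ) * s i, mem_shiftBox.2 (by simp)⟩
  invFun y := ⟨y.1 + fun i => (n : ℤ) * s i, mem_shiftBox.1 y.2⟩
  left_inv y := Subtype.ext (by simp)
  right_inv y := Subtype.ext (by simp)

/-- coordinates of the translate. [folklore] -/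
@[simp] theorem shiftEquiv_val (n : ℕ) (M0 : Fin (d + 1) → ℕ) (s : Fin (d + 1) → ℤ)
    (y : ↥(boxDom (fun i => n * M0 i))) : (shiftEquiv n M0 s y).1 = y.1 - fun i => (n : ℤ) * s i := rfl

/-! ## §2 Translation covariance of the operator (1.6) and of the outer Green's function; `δG` of b04 = `δG` of the lineage -/

/-- the Neumann Laplacian kernel is translation covariant: translating the region and both points changes nothing.
[folklore] -/
theorem neumannLapR_shift {n : ℕ} (M0 : Fin (d + 1) → ℕ) (s : Fin (d + 1) → ℤ) (y y' : Fin (d + 1) → ℤ) :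
    neumannLapR (shiftBox n M0 s) (y - fun i => (n : ℤ) * s i) (y' - fun i => (n : ℤ) * s i)
      = neumannLapR (boxDom (fun i => n * M0 i)) y y' := by
  set t : Fin (d + 1) → ℤ := fun i => (n : ℤ) * s i with ht
  have e2 : y' - t ∈ nbrs (y - t) ↔ y' ∈ nbrs y := by
    have h := mem_nbrs_add_iff (y - t) y' t
    rw [sub_add_cancel] at h
    exact h.symm
  have e3 : ((nbrs (y - t)).filter fun z => z ∈ shiftBox n M0 s).card
      = ((nbrs y).filter fun z => z ∈ boxDom (fun i => n * M0 i)).card := by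
    apply Finset.card_bij (fun z _ => z + t)
    · intro z hz
      rw [Finset.mem_filter] at hz ⊢
      refine ⟨?_, mem_shiftBox.1 hz.2⟩
      have h := mem_nbrs_add_iff (y - t) (z + t) t
      rw [sub_add_cancel, add_sub_cancel_right] at h
      exact h.2 hz.1
    · intro z₁ _ z₂ _ h
      exact add_right_cancel h
    · intro w hw
      rw [Finset.mem_filter] at hw
      refine ⟨w - t, ?_, sub_add_cancel w t⟩
      rw [Finset.mem_filter]
      refine ⟨?_, mem_shiftBox.2 (by rw [sub_add_cancel]; exact hw.2)⟩
      have h := mem_nbrs_add_iff (y - t) w t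
      rw [sub_add_cancel] at h
      exact h.1 hw.1
  unfold neumannLapR
  by_cases h : y' = y
  · subst h
    rw [if_pos rfl, if_pos rfl, e3]
  · have h' : y' - t ≠ y - t := fun e => h (sub_left_injective e)
    rw [if_neg h', if_neg h]
    by_cases hn' : y' ∈ nbrs y
    · rw [if_pos hn', if_pos (e2.2 hn')]
    · rw [if_neg hn', if_neg (mt e2.1 hn')]

/-- **TRANSLATION COVARIANCE OF THE OPERATOR (1.6) AT `A = 0`**: the matrix `fineOpR n a m² (shiftBox)` of
`−Δ^{η,N}_{Ω₀} + m² + aP_k(0)` on the translated outer box, read at translated points, IS the lineage's box operator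
`boxOpR n a m² M₀` (the Laplacian, the mass and the block-averaging kernel `1_{same n-block}` are all covariant under
translations by multiples of `n`). [folklore] -/
theorem fineOpR_shiftBox {n : ℕ} (hn : 1 ≤ n) (a m2 : ℝ) (M0 : Fin (d + 1) → ℕ) (s : Fin (d + 1) → ℤ)
    (y y' : ↥(boxDom (fun i => n * M0 i))) :
    fineOpR n a m2 (shiftBox n M0 s) (shiftEquiv n M0 s y) (shiftEquiv n M0 s y') = boxOpR n a m2 M0 y y' := by
  rw [← fineOpR_boxDom]
  simp only [fineOpR, regionOpR, Matrix.of_apply, shiftEquiv_val]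
  rw [neumannLapR_shift]
  congr 2
  · simp only [diagK, sub_left_inj]
  · simp only [avgK, blk_sub_mul hn, sub_left_inj]

/-- the same as a matrix identity: `fineOpR` of the translated box is `boxOpR` reindexed along the translation.
[folklore] -/
theorem fineOpR_shiftBox_eq {n : ℕ} (hn : 1 ≤ n) (a m2 : ℝ) (M0 : Fin (d + 1) → ℕ) (s : Fin (d + 1) → ℤ) :
    fineOpR n a m2 (shiftBox n M0 s)
      = (boxOpR n a m2 M0).submatrix (shiftEquiv n M0 s).symm (shiftEquiv n M0 s).symm := by
  ext y₁ y₂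
  obtain ⟨z₁, rfl⟩ := (shiftEquiv n M0 s).surjective y₁
  obtain ⟨z₂, rfl⟩ := (shiftEquiv n M0 s).surjective y₂
  rw [Matrix.submatrix_apply, Equiv.symm_apply_apply, Equiv.symm_apply_apply]
  exact fineOpR_shiftBox hn a m2 M0 s z₁ z₂

/-- **THE OUTER GREEN'S FUNCTION `G_k(Ω₀, 0)` ON THE TRANSLATED BOX IS THE LINEAGE'S BOX GREEN'S FUNCTION**:
`((fineOpR n a m² (shiftBox))⁻¹ v)(y − ns) = ((boxOpR n a m² M₀)⁻¹ (v ∘ translation))(y)`. [folklore] -/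
theorem green_shift_mulVec {n : ℕ} (hn : 1 ≤ n) {a m2 : ℝ} {M0 : Fin (d + 1) → ℕ} {s : Fin (d + 1) → ℤ}
    (v : ↥(shiftBox n M0 s) → ℝ) (y : ↥(boxDom (fun i => n * M0 i))) :
    ((fineOpR n a m2 (shiftBox n M0 s))⁻¹.mulVec v) (shiftEquiv n M0 s y)
      = ((boxOpR n a m2 M0)⁻¹.mulVec (v ∘ shiftEquiv n M0 s)) y := by
  rw [fineOpR_shiftBox_eq hn, Matrix.inv_submatrix_equiv, Matrix.submatrix_mulVec_equiv]
  simp only [Function.comp_apply, Equiv.symm_symm, Equiv.symm_apply_apply]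

/-- b04's extension by zero to the translated outer box, pulled back along the translation, IS the lineage's
extension by zero `B4Delta112ZeroBox.ext`. [folklore] -/
theorem extTo_shift {n : ℕ} (M M0 : Fin (d + 1) → ℕ) (s : Fin (d + 1) → ℤ)
    (g : ↥(boxDom (fun i => n * M i)) → ℝ) :
    extTo (shiftBox n M0 s) g ∘ shiftEquiv n M0 s = ext n M M0 s g := by
  funext y
  rfl

/-- b04's inclusion `Ω ↪ Ω₀` of an inner fine point IS the translate of the lineage's embedded point `x + ns`.
[folklore] -/
theorem incl_eq_shift_emb {n : ℕ} {M M0 : Fin (d + 1) → ℕ} {s : Fin (d + 1) → ℤ} (hs : Fits M M0 s)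
    (hsub : boxDom (fun i => n * M i) ⊆ shiftBox n M0 s) (x : ↥(boxDom (fun i => n * M i))) :
    incl hsub x = shiftEquiv n M0 s (emb (hs.scale n) x) :=
  Subtype.ext (by
    show x.1 = (x.1 + fun i => (n : ℤ) * s i) - fun i => (n : ℤ) * s i
    rw [add_sub_cancel_right])

/-- **b04's `δG_k(Ω,Ω₀,0)` (`B4Cor23ZeroDelta.dG`: `G(Ω)g − (G(Ω₀)(ext g))|_Ω` on the carrier's regions) IS THE
LINEAGE'S `δG` (`B4Delta112ZeroBox.dG`: `(boxOpR M)⁻¹g − ((boxOpR M₀)⁻¹(Eg))(· + ns)`) for the nested pair placed with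
`Ω` at the origin.** [cite: Balaban1983RegularityDecay, p. 573 (1.11), case A = 0, dictionary] -/
theorem dG_eq {n : ℕ} (hn : 1 ≤ n) (a m2 : ℝ) {M M0 : Fin (d + 1) → ℕ} {s : Fin (d + 1) → ℤ} (hs : Fits M M0 s)
    (hsub : boxDom (fun i => n * M i) ⊆ shiftBox n M0 s) (g : ↥(boxDom (fun i => n * M i)) → ℝ)
    (x : ↥(boxDom (fun i => n * M i))) :
    B4Cor23ZeroDelta.dG n a m2 hsub g x = B4Delta112ZeroBox.dG n a m2 hs g x := by
  simp only [B4Cor23ZeroDelta.dG, B4Delta112ZeroBox.dG, resTo, Pi.sub_apply]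
  rw [fineOpR_boxDom, incl_eq_shift_emb hs hsub x, green_shift_mulVec hn, extTo_shift]

/-! ## §3 The NESTED-BOX zero-field family (an index type, its map to node 12's `BoxInst` and to b04's instances) -/

/-- **One member of the nested-box zero-field family** (fixed `d`, `L = ℓ + 1`, mass window `[0, m²₊]`): a scale
`k ≥ 1` (mesh `η = L^{-k}`), a NESTED PAIR of boxes of unit blocks `Ω = Π_μ[0, M_μ) ⊂ Ω₀ = Π_μ[−s_μ, M₀_μ − s_μ)`
(`Fits M M₀ s`, `M_μ ≥ 1`), a mass `m² ∈ [0, m²₊]` and the charge coordinate `e` (inert at `A = 0`).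
[cite: Balaban1983RegularityDecay, §1 pp. 572–573 «If Ω ⊂ Ω₀», case A = 0, both regions boxes] -/
structure NestInst (d ℓ : ℕ) (m2plus : ℝ) where
  /-- the scale: `η = L^{-k}` -/
  k : ℕ
  hk : 1 ≤ k
  /-- the inner box `Π_μ [0, M_μ)` in unit-block units -/
  M : Fin (d + 1) → ℕ
  /-- the outer box `Π_μ [0, M₀_μ)` before translation -/
  M0 : Fin (d + 1) → ℕ
  /-- the offset of the inner box inside the outer one -/
  s : Fin (d + 1) → ℤ
  hs : Fits M M0 s
  hM : ∀ i, 1 ≤ M i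
  /-- the mass `m² ∈ [0, m²₊]` -/
  m2 : ℝ
  hm : 0 ≤ m2
  hm' : m2 ≤ m2plus
  /-- the charge (inert at `A = 0`) -/
  e : ℝ

namespace NestInst

variable {ℓ : ℕ} {m2plus : ℝ}

/-- the member as a member of node 12's box family: the box `Ω` at scale `k` with `Ω₀ :=` the translated outer box.
[folklore] -/
def toBox (i : NestInst d ℓ m2plus) : BoxInst d ℓ m2plus where
  k := i.k
  hk := i.hk
  M := i.M
  hM := i.hM
  R₀ := shiftBox ((ℓ + 1) ^ i.k) i.M0 i.s
  hR₀ := shiftBox_isBlockUnion (BoxInst.one_le_Lk ℓ i.k) i.M0 i.s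
  hsub := box_subset_shiftBox i.hs
  m2 := i.m2
  hm := i.hm
  hm' := i.hm'
  e := i.e

/-- the member as one of b04's zero-field instances: `n = L^k`, `R = boxDom (L^k·M)`, `R₀ = shiftBox L^k M₀ s`.
[folklore] -/
def toZF (i : NestInst d ℓ m2plus) : ZeroFieldInstance d := i.toBox.toZF

/-- the mesh denominator of the member. [folklore] -/
theorem toZF_n (i : NestInst d ℓ m2plus) : i.toZF.n = (ℓ + 1) ^ i.k := rfl

/-- the fine region of the member is the inner box at the origin. [folklore] -/
theorem toZF_R (i : NestInst d ℓ m2plus) : i.toZF.R = boxDom (fun j => (ℓ + 1) ^ i.k * i.M j) := rfl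

/-- the outer fine region of the member is the translated outer box. [folklore] -/
theorem toZF_R₀ (i : NestInst d ℓ m2plus) : i.toZF.R₀ = shiftBox ((ℓ + 1) ^ i.k) i.M0 i.s := rfl

/-- **`δG_k(Ω,Ω₀,0)` OF THE MEMBER (b04's field) IS THE LINEAGE'S `δG` OF THE NESTED PAIR.** [folklore] -/
theorem dG_eq (a : ℝ) (i : NestInst d ℓ m2plus) (f : ↥i.toZF.R → ℝ) (x : ↥i.toZF.R) :
    B4Cor23ZeroDelta.dG i.toZF.n a i.toZF.m2 i.toZF.hsub f x
      = B4Delta112ZeroBox.dG ((ℓ + 1) ^ i.k) a i.m2 i.hs f x :=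
  B4Ineq111ZeroNestEta.dG_eq (BoxInst.one_le_Lk ℓ i.k) a i.m2 i.hs _ f x

end NestInst

/-- **THE NESTED-BOX ZERO-FIELD FAMILY** in the cell's carrier (bond convention): member
`i ↦ boxFam ℓ m²₊ a Mb g i.toBox = zeroFieldSettingBond a Mb g i.toZF`. [cite: Balaban1983RegularityDecay, §1
pp. 572–573, case A = 0, nested boxes] -/
def nestFam (ℓ : ℕ) (m2plus a : ℝ) (Mb : ℕ) (g : ∀ i : ZeroFieldInstance d, (↥i.R → ℝ) → ℝ) :
    NestInst d ℓ m2plus → EtaSetting :=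
  fun i => boxFam ℓ m2plus a Mb g i.toBox

/-- the member of the family is b04's carrier (bond convention) of the member's instance. [folklore] -/
theorem nestFam_eq (ℓ : ℕ) (m2plus a : ℝ) (Mb : ℕ) (g : ∀ i : ZeroFieldInstance d, (↥i.R → ℝ) → ℝ)
    (i : NestInst d ℓ m2plus) : nestFam ℓ m2plus a Mb g i = zeroFieldSettingBond a Mb g i.toZF := rfl

/-- the same family in b04's VERBATIM carrier `zeroFieldSettingB` (for the two (1.10)·(1.12) clauses, which read
identical fields; its unguarded Hölder field `dlhs19` is NOT claimed — `B4Ineq19ZeroBoxEta`, OBSERVATION (O-bond)).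
[folklore] -/
def nestFamB (ℓ : ℕ) (m2plus a : ℝ) (Mb : ℕ) (g : ∀ i : ZeroFieldInstance d, (↥i.R → ℝ) → ℝ) :
    NestInst d ℓ m2plus → EtaSetting :=
  fun i => zeroFieldSettingB a Mb g i.toZF

section MemberFacts

variable (ℓ : ℕ) (m2plus a : ℝ) (Mb : ℕ) (g : ∀ i : ZeroFieldInstance d, (↥i.R → ℝ) → ℝ) (i : NestInst d ℓ m2plus)

/-- **THE CARRIER'S `δG` FIELD OF A MEMBER IS THE LINEAGE'S `δG` OF ITS NESTED PAIR**: `dvalG f x = |δG f(x)|` with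
`δG = B4Delta112ZeroBox.dG L^k a m² (Fits M M₀ s)`. [cite: Balaban1983RegularityDecay, p. 573 (1.11), case A = 0,
dictionary] -/
theorem nestFam_dvalG (f : ↥i.toZF.R → ℝ) (x : ↥i.toZF.R) :
    (nestFam ℓ m2plus a Mb g i).dvalG f x = |B4Delta112ZeroBox.dG ((ℓ + 1) ^ i.k) a i.m2 i.hs f x| := by
  show |B4Cor23ZeroDelta.dG i.toZF.n a i.toZF.m2 i.toZF.hsub f x| = _
  rw [NestInst.dG_eq]

/-- the derivative field likewise: `dvalDG μ f x = |D_μ δG f(x)|` on the bonds of `Ω`. [folklore] -/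
theorem nestFam_dvalDG (μ : Fin (d + 1)) (f : ↥i.toZF.R → ℝ) (x : ↥i.toZF.R) :
    (nestFam ℓ m2plus a Mb g i).dvalDG μ f x
      = |fdiff ((ℓ + 1) ^ i.k) i.toZF.R μ (B4Delta112ZeroBox.dG ((ℓ + 1) ^ i.k) a i.m2 i.hs f) x| := by
  show |fdiff i.toZF.n i.toZF.R μ (B4Cor23ZeroDelta.dG i.toZF.n a i.toZF.m2 i.toZF.hsub f) x| = _
  have e : B4Cor23ZeroDelta.dG i.toZF.n a i.toZF.m2 i.toZF.hsub f
      = B4Delta112ZeroBox.dG ((ℓ + 1) ^ i.k) a i.m2 i.hs f := funext (NestInst.dG_eq a i f)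
  rw [e]
  rfl

/-- the Hölder field likewise: `dlhs19 α μ f x x′ = holderQ(δG f)` (bond convention). [folklore] -/
theorem nestFam_dlhs19 (α : ℝ) (μ : Fin (d + 1)) (f : ↥i.toZF.R → ℝ) (x x' : ↥i.toZF.R) :
    (nestFam ℓ m2plus a Mb g i).dlhs19 α μ f x x'
      = holderQ ((ℓ + 1) ^ i.k) i.toZF.R α μ (B4Delta112ZeroBox.dG ((ℓ + 1) ^ i.k) a i.m2 i.hs f) x x' := by
  show holderQ i.toZF.n i.toZF.R α μ (B4Cor23ZeroDelta.dG i.toZF.n a i.toZF.m2 i.toZF.hsub f) x x' = _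
  have e : B4Cor23ZeroDelta.dG i.toZF.n a i.toZF.m2 i.toZF.hsub f
      = B4Delta112ZeroBox.dG ((ℓ + 1) ^ i.k) a i.m2 i.hs f := funext (NestInst.dG_eq a i f)
  rw [e]
  rfl

/-- the boundary field of a member is the assignment `g`: `bdistS f = g i f`. [folklore] -/
theorem nestFam_bdistS (f : ↥i.toZF.R → ℝ) : (nestFam ℓ m2plus a Mb g i).bdistS f = g i.toZF f := rfl

/-- the inner box is a rectangular parallelepiped: the typed antecedent `rect ∨ …` of both `Ineq19_110` and
`Ineq111_112` is met at every pair of points («without any restrictions on the points x, x′»).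
[cite: Balaban1983RegularityDecay, Theorem p. 573, last sentence] -/
theorem nestFam_rect : (nestFam ℓ m2plus a Mb g i).rect := BoxInst.rect a Mb g i.toBox

end MemberFacts

section CarrierFacts

variable (a : ℝ) (Mb : ℕ) (g : ∀ i : ZeroFieldInstance d, (↥i.R → ℝ) → ℝ) (i : ZeroFieldInstance d)

/-- **`B4.Ineq111_112` READ ON THE CARRIER, UNFOLDED** (by `Iff.rfl`): the typed (1.11)–(1.12) of instance `i` say —
for all `μ, f, x, x′` meeting the typed antecedent — `holderQ(δG f) ≤ c₀e^{−δ₀d({x,x′},supp f)}e^{−(δ₀d({x,x′},Ω₀∖Ω) + δ₀g(f))}‖f‖_∞`,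
`|D_μδG f(x)| ≤ …` and `|δG f(x)| ≤ …` with `δG = δG_k(Ω,Ω₀,0) = B4Cor23ZeroDelta.dG`.
[cite: Balaban1983RegularityDecay, Theorem p. 573 (1.11)–(1.12), case A = 0, dictionary] -/
theorem ineq111_112_bond_iff (α δ₀ c₀ R₀ : ℝ) :
    Ineq111_112 (zeroFieldSettingBond a Mb g i) α δ₀ c₀ R₀ ↔
      (∀ (μ : Fin (d + 1)) (f : ↥i.R → ℝ) (x x' : ↥i.R),
          ((zeroFieldSettingBond a Mb g i).rect ∨ R₀ ≤ (zeroFieldSettingBond a Mb g i).bdist2 x x') →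
          holderQ i.n i.R α μ (B4Cor23ZeroDelta.dG i.n a i.m2 i.hsub f) x x' ≤
            c₀ * Real.exp (-(δ₀ * setDist (edistR i.n i.R) ({x} ∪ {x'}) (supp f))) *
              Real.exp (-(δ₀ * setDist (edistR i.n i.R₀) ({incl i.hsub x} ∪ {incl i.hsub x'}) (outR i.R i.R₀)
                + δ₀ * g i f)) * i.supN f) ∧
      (∀ (μ : Fin (d + 1)) (f : ↥i.R → ℝ) (x : ↥i.R),
          ((zeroFieldSettingBond a Mb g i).rect ∨ R₀ ≤ (zeroFieldSettingBond a Mb g i).bdist1 x) →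
          |fdiff i.n i.R μ (B4Cor23ZeroDelta.dG i.n a i.m2 i.hsub f) x| ≤
              c₀ * Real.exp (-(δ₀ * setDist (edistR i.n i.R) {x} (supp f))) *
                Real.exp (-(δ₀ * setDist (edistR i.n i.R₀) {incl i.hsub x} (outR i.R i.R₀) + δ₀ * g i f)) *
                  i.supN f ∧
            |B4Cor23ZeroDelta.dG i.n a i.m2 i.hsub f x| ≤
              c₀ * Real.exp (-(δ₀ * setDist (edistR i.n i.R) {x} (supp f))) *
                Real.exp (-(δ₀ * setDist (edistR i.n i.R₀) {incl i.hsub x} (outR i.R i.R₀) + δ₀ * g i f)) *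
                  i.supN f) :=
  Iff.rfl

/-- the second conjunct of `Ineq111_112` (the two (1.10)·(1.12) clauses) transfers from the bond-convention carrier to
b04's VERBATIM carrier `zeroFieldSettingB`, whose fields `dvalDG`, `dvalG`, `sdist1`, `bdist1`, `bdistS`, `supNorm`,
`rect` are the same. [folklore] -/
theorem ineq112_B_of_bond {α δ₀ c₀ R₀ : ℝ} (h : Ineq111_112 (zeroFieldSettingBond a Mb g i) α δ₀ c₀ R₀) :
    ∀ (μ : (zeroFieldSettingB a Mb g i).Dir) (f : (zeroFieldSettingB a Mb g i).Src)
      (x : (zeroFieldSettingB a Mb g i).Site),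
      ((zeroFieldSettingB a Mb g i).rect ∨ R₀ ≤ (zeroFieldSettingB a Mb g i).bdist1 x) →
        (zeroFieldSettingB a Mb g i).dvalDG μ f x ≤
            c₀ * Real.exp (-(δ₀ * (zeroFieldSettingB a Mb g i).sdist1 x f)) *
              Real.exp (-(δ₀ * (zeroFieldSettingB a Mb g i).bdist1 x + δ₀ * (zeroFieldSettingB a Mb g i).bdistS f)) *
                (zeroFieldSettingB a Mb g i).supNorm f ∧
          (zeroFieldSettingB a Mb g i).dvalG f x ≤
            c₀ * Real.exp (-(δ₀ * (zeroFieldSettingB a Mb g i).sdist1 x f)) *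
              Real.exp (-(δ₀ * (zeroFieldSettingB a Mb g i).bdist1 x + δ₀ * (zeroFieldSettingB a Mb g i).bdistS f)) *
                (zeroFieldSettingB a Mb g i).supNorm f :=
  ((ineq111_112_bond_iff a Mb g i α δ₀ c₀ R₀).1 h).2

end CarrierFacts

/-! ## §4 Dictionary lemmas: the carrier's boundary distances and `g` against the lineage's hypotheses -/

section Dictionary

variable {ℓ : ℕ} {m2plus : ℝ}

/-- `L^k·dist_η(x, Ω₀∖Ω) ≤ |(x + ns) − y|_∞` for every outer fine point `y` off the inner box (the lineage's
hypothesis shape `hDb`). [folklore] -/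
theorem Db1_le (i : NestInst d ℓ m2plus) (x : ↥i.toZF.R) (y : ↥(boxDom (fun j => (ℓ + 1) ^ i.k * i.M0 j)))
    (hy : (y.1 - fun j => ((((ℓ + 1) ^ i.k : ℕ) : ℤ)) * i.s j) ∉ boxDom (fun j => (ℓ + 1) ^ i.k * i.M j)) :
    (((ℓ + 1) ^ i.k : ℕ) : ℝ) * setDist (edistR i.toZF.n i.toZF.R₀) {incl i.toZF.hsub x} (outR i.toZF.R i.toZF.R₀)
      ≤ supNorm ((emb (i.hs.scale ((ℓ + 1) ^ i.k)) x).1 - y.1) := by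
  have hy' : shiftEquiv ((ℓ + 1) ^ i.k) i.M0 i.s y ∈ outR i.toZF.R i.toZF.R₀ := mem_outR.2 hy
  have h := setDist_le (edistR i.toZF.n i.toZF.R₀) (Finset.mem_singleton_self (incl i.toZF.hsub x)) hy'
  have hn := Lk_pos ℓ i.k
  unfold edistR at h
  rw [NestInst.toZF_n] at h
  have e : (incl i.toZF.hsub x).1 - (shiftEquiv ((ℓ + 1) ^ i.k) i.M0 i.s y).1
      = (emb (i.hs.scale ((ℓ + 1) ^ i.k)) x).1 - y.1 := by
    show x.1 - (y.1 - _) = (x.1 + _) - y.1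
    rw [sub_sub_eq_add_sub]
  rw [e] at h
  calc (((ℓ + 1) ^ i.k : ℕ) : ℝ) * setDist (edistR i.toZF.n i.toZF.R₀) {incl i.toZF.hsub x} (outR i.toZF.R i.toZF.R₀)
      ≤ (((ℓ + 1) ^ i.k : ℕ) : ℝ) * (1 / (((ℓ + 1) ^ i.k : ℕ) : ℝ)
          * supNorm ((emb (i.hs.scale ((ℓ + 1) ^ i.k)) x).1 - y.1)) := mul_le_mul_of_nonneg_left h hn.le
    _ = supNorm ((emb (i.hs.scale ((ℓ + 1) ^ i.k)) x).1 - y.1) := by field_simp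

/-- the same for the pair `{x, x′}`. [folklore] -/
theorem Db2_le (i : NestInst d ℓ m2plus) (x x' : ↥i.toZF.R) (y : ↥(boxDom (fun j => (ℓ + 1) ^ i.k * i.M0 j)))
    (hy : (y.1 - fun j => ((((ℓ + 1) ^ i.k : ℕ) : ℤ)) * i.s j) ∉ boxDom (fun j => (ℓ + 1) ^ i.k * i.M j)) :
    (((ℓ + 1) ^ i.k : ℕ) : ℝ) * setDist (edistR i.toZF.n i.toZF.R₀) ({incl i.toZF.hsub x} ∪ {incl i.toZF.hsub x'})
        (outR i.toZF.R i.toZF.R₀)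
      ≤ min (supNorm ((emb (i.hs.scale ((ℓ + 1) ^ i.k)) x).1 - y.1))
          (supNorm ((emb (i.hs.scale ((ℓ + 1) ^ i.k)) x').1 - y.1)) := by
  have hy' : shiftEquiv ((ℓ + 1) ^ i.k) i.M0 i.s y ∈ outR i.toZF.R i.toZF.R₀ := mem_outR.2 hy
  have hn := Lk_pos ℓ i.k
  have key : ∀ z : ↥i.toZF.R, incl i.toZF.hsub z ∈ ({incl i.toZF.hsub x} ∪ {incl i.toZF.hsub x'} : Finset ↥i.toZF.R₀) →
      (((ℓ + 1) ^ i.k : ℕ) : ℝ) * setDist (edistR i.toZF.n i.toZF.R₀) ({incl i.toZF.hsub x} ∪ {incl i.toZF.hsub x'})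
          (outR i.toZF.R i.toZF.R₀)
        ≤ supNorm ((emb (i.hs.scale ((ℓ + 1) ^ i.k)) z).1 - y.1) := by
    intro z hz
    have h := setDist_le (edistR i.toZF.n i.toZF.R₀) hz hy'
    unfold edistR at h
    rw [NestInst.toZF_n] at h
    have e : (incl i.toZF.hsub z).1 - (shiftEquiv ((ℓ + 1) ^ i.k) i.M0 i.s y).1
        = (emb (i.hs.scale ((ℓ + 1) ^ i.k)) z).1 - y.1 := by
      show z.1 - (y.1 - _) = (z.1 + _) - y.1
      rw [sub_sub_eq_add_sub]
    rw [e] at h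
    calc (((ℓ + 1) ^ i.k : ℕ) : ℝ) * setDist (edistR i.toZF.n i.toZF.R₀) ({incl i.toZF.hsub x} ∪ {incl i.toZF.hsub x'})
            (outR i.toZF.R i.toZF.R₀)
        ≤ (((ℓ + 1) ^ i.k : ℕ) : ℝ) * (1 / (((ℓ + 1) ^ i.k : ℕ) : ℝ)
            * supNorm ((emb (i.hs.scale ((ℓ + 1) ^ i.k)) z).1 - y.1)) := mul_le_mul_of_nonneg_left h hn.le
      _ = supNorm ((emb (i.hs.scale ((ℓ + 1) ^ i.k)) z).1 - y.1) := by field_simp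
  exact le_min (key x (by simp)) (key x' (by simp))

/-- **THE BOUNDARY FACTOR OF (1.12)**: for an ADMISSIBLE assignment `g` (b04's hypothesis of
`cor23Printed_zeroFieldB`: `g i f ≤ dist_η(supp f, Ω₀∖Ω)` whenever both sets are non-empty), `L^k·max(g(f), 0)` is
below every lattice distance `|(z + ns) − y|_∞` from a point `z ∈ supp f` to an outer point `y` off the inner box (the
lineage's hypothesis shape `hDf`). [cite: Balaban1983RegularityDecay, p. 573 (1.12) «dist(supp f, Ω^c)», dictionary] -/
theorem Df_le {g : ∀ i : ZeroFieldInstance d, (↥i.R → ℝ) → ℝ}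
    (hg : ∀ (i : ZeroFieldInstance d) (f : ↥i.R → ℝ),
      (outR i.R i.R₀).Nonempty → (supp f).Nonempty → g i f ≤ bdist i.n i.hsub f)
    (i : NestInst d ℓ m2plus) (f : ↥i.toZF.R → ℝ) (z : ↥i.toZF.R) (hz : f z ≠ 0)
    (y : ↥(boxDom (fun j => (ℓ + 1) ^ i.k * i.M0 j)))
    (hy : (y.1 - fun j => ((((ℓ + 1) ^ i.k : ℕ) : ℤ)) * i.s j) ∉ boxDom (fun j => (ℓ + 1) ^ i.k * i.M j)) :
    (((ℓ + 1) ^ i.k : ℕ) : ℝ) * max (g i.toZF f) 0 ≤ supNorm ((emb (i.hs.scale ((ℓ + 1) ^ i.k)) z).1 - y.1) := by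
  have hy' : shiftEquiv ((ℓ + 1) ^ i.k) i.M0 i.s y ∈ outR i.toZF.R i.toZF.R₀ := mem_outR.2 hy
  have hzs : z ∈ supp f := mem_supp.2 hz
  have hn := Lk_pos ℓ i.k
  have h1 : g i.toZF f ≤ bdist i.toZF.n i.toZF.hsub f := hg i.toZF f ⟨_, hy'⟩ ⟨z, hzs⟩
  have h2 : bdist i.toZF.n i.toZF.hsub f
      ≤ edistR i.toZF.n i.toZF.R₀ (incl i.toZF.hsub z) (shiftEquiv ((ℓ + 1) ^ i.k) i.M0 i.s y) :=
    bdist_le i.toZF.hsub f hzs hy'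
  have hmax : max (g i.toZF f) 0
      ≤ edistR i.toZF.n i.toZF.R₀ (incl i.toZF.hsub z) (shiftEquiv ((ℓ + 1) ^ i.k) i.M0 i.s y) :=
    max_le (h1.trans h2) (edistR_nonneg _ _)
  unfold edistR at hmax
  rw [NestInst.toZF_n] at hmax
  have e : (incl i.toZF.hsub z).1 - (shiftEquiv ((ℓ + 1) ^ i.k) i.M0 i.s y).1
      = (emb (i.hs.scale ((ℓ + 1) ^ i.k)) z).1 - y.1 := by
    show z.1 - (y.1 - _) = (z.1 + _) - y.1
    rw [sub_sub_eq_add_sub]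
  rw [e] at hmax
  calc (((ℓ + 1) ^ i.k : ℕ) : ℝ) * max (g i.toZF f) 0
      ≤ (((ℓ + 1) ^ i.k : ℕ) : ℝ) * (1 / (((ℓ + 1) ^ i.k : ℕ) : ℝ)
          * supNorm ((emb (i.hs.scale ((ℓ + 1) ^ i.k)) z).1 - y.1)) := mul_le_mul_of_nonneg_left hmax hn.le
    _ = supNorm ((emb (i.hs.scale ((ℓ + 1) ^ i.k)) z).1 - y.1) := by field_simp

/-- **MONOTONICITY OF THE PRINTED BOUND (1.9)–(1.10)·(1.12) IN THE CONSTANTS** together with the exponent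
bookkeeping: from the lineage's `c·e^{−δD/L^k}·e^{−(δD_b/L^k + δD_f/L^k)}·F` with `D = L^k·s_d`, `D_b = L^k·b_d`,
`D_f = L^k·m` (`m = max(g, 0) ≥ g`) to the carrier's `c′·e^{−δ′s_d}·e^{−(δ′b_d + δ′g)}·F` for `c ≤ c′`, `0 ≤ δ′ ≤ δ`.
[folklore] -/
theorem transfer12 {ℓ k : ℕ} {P c c' δ δ' sd bd gv mx F : ℝ} (hc : c ≤ c') (hδ : δ' ≤ δ) (hδ' : 0 ≤ δ')
    (hc0 : 0 ≤ c) (hsd : 0 ≤ sd) (hbd : 0 ≤ bd) (hmx : 0 ≤ mx) (hgv : gv ≤ mx) (hF : 0 ≤ F)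
    (h : P ≤ c * Real.exp (-(δ * ((((ℓ + 1) ^ k : ℕ) : ℝ) * sd) / (((ℓ + 1) ^ k : ℕ) : ℝ)))
      * Real.exp (-(δ * ((((ℓ + 1) ^ k : ℕ) : ℝ) * bd) / (((ℓ + 1) ^ k : ℕ) : ℝ)
          + δ * ((((ℓ + 1) ^ k : ℕ) : ℝ) * mx) / (((ℓ + 1) ^ k : ℕ) : ℝ))) * F) :
    P ≤ c' * Real.exp (-(δ' * sd)) * Real.exp (-(δ' * bd + δ' * gv)) * F := by
  rw [exp_arg, exp_arg, exp_arg] at h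
  refine h.trans ?_
  have h1 : Real.exp (-(δ * sd)) ≤ Real.exp (-(δ' * sd)) :=
    Real.exp_le_exp.2 (by nlinarith [mul_le_mul_of_nonneg_right hδ hsd])
  have h2 : Real.exp (-(δ * bd + δ * mx)) ≤ Real.exp (-(δ' * bd + δ' * gv)) :=
    Real.exp_le_exp.2 (by nlinarith [mul_le_mul_of_nonneg_right hδ hbd, mul_le_mul_of_nonneg_right hδ hmx,
      mul_le_mul_of_nonneg_left hgv hδ'])
  have h3 : c * Real.exp (-(δ * sd)) * Real.exp (-(δ * bd + δ * mx))
      ≤ c' * Real.exp (-(δ' * sd)) * Real.exp (-(δ' * bd + δ' * gv)) :=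
    mul_le_mul (mul_le_mul hc h1 (Real.exp_pos _).le (hc0.trans hc)) h2 (Real.exp_pos _).le
      (mul_nonneg (hc0.trans hc) (Real.exp_pos _).le)
  exact mul_le_mul_of_nonneg_right h3 hF

/-- monotonicity of a bound `c·e^{−δs}·F` in the constants (`s, F ≥ 0`). [folklore] -/
theorem weaken {P c c' δ δ' s F : ℝ} (hc : c ≤ c') (hδ : δ' ≤ δ) (hc0 : 0 ≤ c) (hs : 0 ≤ s) (hF : 0 ≤ F)
    (h : P ≤ c * Real.exp (-(δ * s)) * F) : P ≤ c' * Real.exp (-(δ' * s)) * F := by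
  refine h.trans ?_
  have he : Real.exp (-(δ * s)) ≤ Real.exp (-(δ' * s)) :=
    Real.exp_le_exp.2 (by nlinarith [mul_le_mul_of_nonneg_right hδ hs])
  exact mul_le_mul_of_nonneg_right (mul_le_mul hc he (Real.exp_pos _).le (hc0.trans hc)) hF

/-- a bound `0 ≤ c·e^{a}·e^{b}·‖f‖_∞`. [folklore] -/
theorem rhs12_nonneg {c u v : ℝ} (hc : 0 ≤ c) (i : ZeroFieldInstance d) (f : ↥i.R → ℝ) :
    0 ≤ c * Real.exp u * Real.exp v * i.supN f :=
  mul_nonneg (mul_nonneg (mul_nonneg hc (Real.exp_pos _).le) (Real.exp_pos _).le) (supN_nonneg i f)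

end Dictionary

/-! ## §5 The three clauses of (1.11)–(1.12) on every member, from the lineage's nested-box theorems -/

section Clauses

variable {ℓ : ℕ} {m2plus : ℝ}

/-- **CLAUSE (1.9)·(1.12) FOR `δG_k(Ω,Ω₀,0)` ON EVERY NESTED PAIR OF BOXES, in the bond convention**, for
`0 ≤ α < 1` and an admissible `g`: constants `δ₀, c₀ > 0` (one pair for the whole family; `c₀` depends on `α`) such
that for every `0 < δ ≤ δ₀`, `c ≥ c₀`, every member, direction `μ`, source `f` and points `x, x′` of `Ω`,
`|x − x′|_η^{−α}|(D_μδG f)(x′) − (D_μδG f)(x)| ≤ c·e^{−δdist_η({x,x′},supp f)}·e^{−(δdist_η({x,x′},Ω₀∖Ω) + δg(f))}‖f‖_∞`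
(pairs of bonds of `Ω`; `0` otherwise) — from `B4Delta112ZeroBoxHolder.delta112_zero_box_holder_coeff` (node 11).
[cite: Balaban1983RegularityDecay, Theorem p. 573 (1.9)·(1.11)·(1.12), case A = 0, nested boxes, 0 ≤ α < 1] -/
theorem dlhs19_bound (hℓ : 1 ≤ ℓ) (a : ℝ) (ha : 0 < a) {g : ∀ i : ZeroFieldInstance d, (↥i.R → ℝ) → ℝ}
    (hg : ∀ (i : ZeroFieldInstance d) (f : ↥i.R → ℝ),
      (outR i.R i.R₀).Nonempty → (supp f).Nonempty → g i f ≤ bdist i.n i.hsub f)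
    (α : ℝ) (hα0 : 0 ≤ α) (hα1 : α < 1) :
    ∃ δ₀ c₀ : ℝ, 0 < δ₀ ∧ 0 < c₀ ∧ ∀ (δ c : ℝ), 0 < δ → δ ≤ δ₀ → c₀ ≤ c →
      ∀ (i : NestInst d ℓ m2plus) (μ : Fin (d + 1)) (f : ↥i.toZF.R → ℝ) (x x' : ↥i.toZF.R),
      holderQ i.toZF.n i.toZF.R α μ (B4Cor23ZeroDelta.dG i.toZF.n a i.toZF.m2 i.toZF.hsub f) x x'
        ≤ c * Real.exp (-(δ * setDist (edistR i.toZF.n i.toZF.R) ({x} ∪ {x'}) (supp f)))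
          * Real.exp (-(δ * setDist (edistR i.toZF.n i.toZF.R₀) ({incl i.toZF.hsub x} ∪ {incl i.toZF.hsub x'})
              (outR i.toZF.R i.toZF.R₀) + δ * g i.toZF f)) * i.toZF.supN f := by
  obtain ⟨δ₀, c₀, hδ, hc, h⟩ := delta112_zero_box_holder_coeff d ℓ hℓ a a m2plus ha α hα0 hα1
  refine ⟨δ₀, c₀, hδ, hc, fun δ c hδ0 hδle hcle i μ f x x' => ?_⟩
  have hF := supN_nonneg i.toZF f
  have hsd := setDist_edistR_nonneg (n := i.toZF.n) ({x} ∪ {x'}) (supp f)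
  have hbd := setDist_edistR_nonneg (n := i.toZF.n) ({incl i.toZF.hsub x} ∪ {incl i.toZF.hsub x'})
    (outR i.toZF.R i.toZF.R₀)
  have h0 := rhs12_nonneg (u := -(δ * setDist (edistR i.toZF.n i.toZF.R) ({x} ∪ {x'}) (supp f)))
    (v := -(δ * setDist (edistR i.toZF.n i.toZF.R₀) ({incl i.toZF.hsub x} ∪ {incl i.toZF.hsub x'})
      (outR i.toZF.R i.toZF.R₀) + δ * g i.toZF f)) (hc.le.trans hcle) i.toZF f
  by_cases hb : x.1 + uvec μ ∈ i.toZF.R ∧ x'.1 + uvec μ ∈ i.toZF.R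
  swap
  · rw [holderQ_of_not_bond α _ hb]
    exact h0
  obtain ⟨hx, hx'⟩ := hb
  rw [holderQ_of_bond α _ hx hx']
  by_cases hxx : x'.1 = x.1
  · have hx'x : x' = x := Subtype.ext hxx
    subst hx'x
    rw [sub_self, abs_zero, mul_zero]
    exact h0
  rw [edistR_rpow_neg, fdiff_eq _ x hx, fdiff_eq _ x' hx']
  simp only [NestInst.dG_eq a i f]
  have key := h i.k i.hk a i.m2 le_rfl le_rfl i.hm i.hm' i.M i.M0 i.s i.hs i.hM f (i.toZF.supN f)
    (fun z => abs_le_supN i.toZF f z) μ x (nbr x hx) x' (nbr x' hx') (nbr_val x hx) (nbr_val x' hx') hxx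
    ((((ℓ + 1) ^ i.k : ℕ) : ℝ) * setDist (edistR i.toZF.n i.toZF.R) ({x} ∪ {x'}) (supp f))
    ((((ℓ + 1) ^ i.k : ℕ) : ℝ) * setDist (edistR i.toZF.n i.toZF.R₀) ({incl i.toZF.hsub x} ∪ {incl i.toZF.hsub x'})
      (outR i.toZF.R i.toZF.R₀))
    ((((ℓ + 1) ^ i.k : ℕ) : ℝ) * max (g i.toZF f) 0)
    (fun z hz => D2_le i.toBox f x x' z hz) (fun y hy => Db2_le i x x' y hy) (fun z hz y hy => Df_le hg i f z hz y hy)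
  have e : ∀ (n p q r s : ℝ), n * (p - q) - n * (r - s) = n * ((p - q) - (r - s)) := fun n p q r s => by ring
  rw [e]
  exact transfer12 hcle hδle hδ0.le hc.le hsd hbd (le_max_right _ _) (le_max_left _ _) hF key

/-- **CLAUSE (1.10)·(1.12), DERIVATIVE, FOR `δG_k(Ω,Ω₀,0)` ON EVERY NESTED PAIR OF BOXES** (admissible `g`):
`|(D_μδG f)(x)| ≤ c·e^{−δdist_η(x,supp f)}·e^{−(δdist_η(x,Ω₀∖Ω) + δg(f))}‖f‖_∞` (`D_μ = 0` off bonds) — from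
`B4Delta112ZeroBox.delta112_zero_box_deriv_coeff` (node 9).
[cite: Balaban1983RegularityDecay, Theorem p. 573 (1.10)·(1.11)·(1.12) first quantity, case A = 0, nested boxes] -/
theorem dvalDG_bound (hℓ : 1 ≤ ℓ) (a : ℝ) (ha : 0 < a) {g : ∀ i : ZeroFieldInstance d, (↥i.R → ℝ) → ℝ}
    (hg : ∀ (i : ZeroFieldInstance d) (f : ↥i.R → ℝ),
      (outR i.R i.R₀).Nonempty → (supp f).Nonempty → g i f ≤ bdist i.n i.hsub f) :
    ∃ δ₀ c₀ : ℝ, 0 < δ₀ ∧ 0 < c₀ ∧ ∀ (δ c : ℝ), 0 < δ → δ ≤ δ₀ → c₀ ≤ c →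
      ∀ (i : NestInst d ℓ m2plus) (μ : Fin (d + 1)) (f : ↥i.toZF.R → ℝ) (x : ↥i.toZF.R),
      |fdiff i.toZF.n i.toZF.R μ (B4Cor23ZeroDelta.dG i.toZF.n a i.toZF.m2 i.toZF.hsub f) x|
        ≤ c * Real.exp (-(δ * setDist (edistR i.toZF.n i.toZF.R) {x} (supp f)))
          * Real.exp (-(δ * setDist (edistR i.toZF.n i.toZF.R₀) {incl i.toZF.hsub x} (outR i.toZF.R i.toZF.R₀)
              + δ * g i.toZF f)) * i.toZF.supN f := by
  obtain ⟨δ₀, c₀, hδ, hc, h⟩ := delta112_zero_box_deriv_coeff d ℓ hℓ a a m2plus ha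
  refine ⟨δ₀, c₀, hδ, hc, fun δ c hδ0 hδle hcle i μ f x => ?_⟩
  have hF := supN_nonneg i.toZF f
  have hsd := setDist_edistR_nonneg (n := i.toZF.n) {x} (supp f)
  have hbd := setDist_edistR_nonneg (n := i.toZF.n) {incl i.toZF.hsub x} (outR i.toZF.R i.toZF.R₀)
  have h0 := rhs12_nonneg (u := -(δ * setDist (edistR i.toZF.n i.toZF.R) {x} (supp f)))
    (v := -(δ * setDist (edistR i.toZF.n i.toZF.R₀) {incl i.toZF.hsub x} (outR i.toZF.R i.toZF.R₀)
      + δ * g i.toZF f)) (hc.le.trans hcle) i.toZF f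
  by_cases hx : x.1 + uvec μ ∈ i.toZF.R
  swap
  · rw [fdiff_of_not_mem _ hx, abs_zero]
    exact h0
  rw [fdiff_eq _ x hx]
  simp only [NestInst.dG_eq a i f]
  have key := h i.k i.hk a i.m2 le_rfl le_rfl i.hm i.hm' i.M i.M0 i.s i.hs i.hM f (i.toZF.supN f)
    (fun z => abs_le_supN i.toZF f z) μ x (nbr x hx) (nbr_val x hx)
    ((((ℓ + 1) ^ i.k : ℕ) : ℝ) * setDist (edistR i.toZF.n i.toZF.R) {x} (supp f))
    ((((ℓ + 1) ^ i.k : ℕ) : ℝ) * setDist (edistR i.toZF.n i.toZF.R₀) {incl i.toZF.hsub x} (outR i.toZF.R i.toZF.R₀))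
    ((((ℓ + 1) ^ i.k : ℕ) : ℝ) * max (g i.toZF f) 0)
    (fun z hz => D1_le i.toBox f x z hz) (fun y hy => Db1_le i x y hy) (fun z hz y hy => Df_le hg i f z hz y hy)
  exact transfer12 hcle hδle hδ0.le hc.le hsd hbd (le_max_right _ _) (le_max_left _ _) hF key

/-- **CLAUSE (1.10)·(1.12), VALUE, FOR `δG_k(Ω,Ω₀,0)` ON EVERY NESTED PAIR OF BOXES** (admissible `g`):
`|(δG f)(x)| ≤ c·e^{−δdist_η(x,supp f)}·e^{−(δdist_η(x,Ω₀∖Ω) + δg(f))}‖f‖_∞` — from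
`B4Delta112ZeroBox.delta112_zero_box_value_coeff` (node 9).
[cite: Balaban1983RegularityDecay, Theorem p. 573 (1.10)·(1.11)·(1.12) second quantity, case A = 0, nested boxes] -/
theorem dvalG_bound (hℓ : 1 ≤ ℓ) (a : ℝ) (ha : 0 < a) {g : ∀ i : ZeroFieldInstance d, (↥i.R → ℝ) → ℝ}
    (hg : ∀ (i : ZeroFieldInstance d) (f : ↥i.R → ℝ),
      (outR i.R i.R₀).Nonempty → (supp f).Nonempty → g i f ≤ bdist i.n i.hsub f) :
    ∃ δ₀ c₀ : ℝ, 0 < δ₀ ∧ 0 < c₀ ∧ ∀ (δ c : ℝ), 0 < δ → δ ≤ δ₀ → c₀ ≤ c →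
      ∀ (i : NestInst d ℓ m2plus) (f : ↥i.toZF.R → ℝ) (x : ↥i.toZF.R),
      |B4Cor23ZeroDelta.dG i.toZF.n a i.toZF.m2 i.toZF.hsub f x|
        ≤ c * Real.exp (-(δ * setDist (edistR i.toZF.n i.toZF.R) {x} (supp f)))
          * Real.exp (-(δ * setDist (edistR i.toZF.n i.toZF.R₀) {incl i.toZF.hsub x} (outR i.toZF.R i.toZF.R₀)
              + δ * g i.toZF f)) * i.toZF.supN f := by
  obtain ⟨δ₀, c₀, hδ, hc, h⟩ := delta112_zero_box_value_coeff d ℓ hℓ a a m2plus ha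
  refine ⟨δ₀, c₀, hδ, hc, fun δ c hδ0 hδle hcle i f x => ?_⟩
  have hF := supN_nonneg i.toZF f
  have hsd := setDist_edistR_nonneg (n := i.toZF.n) {x} (supp f)
  have hbd := setDist_edistR_nonneg (n := i.toZF.n) {incl i.toZF.hsub x} (outR i.toZF.R i.toZF.R₀)
  rw [NestInst.dG_eq a i f]
  have key := h i.k i.hk a i.m2 le_rfl le_rfl i.hm i.hm' i.M i.M0 i.s i.hs i.hM f (i.toZF.supN f)
    (fun z => abs_le_supN i.toZF f z) x
    ((((ℓ + 1) ^ i.k : ℕ) : ℝ) * setDist (edistR i.toZF.n i.toZF.R) {x} (supp f))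
    ((((ℓ + 1) ^ i.k : ℕ) : ℝ) * setDist (edistR i.toZF.n i.toZF.R₀) {incl i.toZF.hsub x} (outR i.toZF.R i.toZF.R₀))
    ((((ℓ + 1) ^ i.k : ℕ) : ℝ) * max (g i.toZF f) 0)
    (fun z hz => D1_le i.toBox f x z hz) (fun y hy => Db1_le i x y hy) (fun z hz y hy => Df_le hg i f z hz y hy)
  exact transfer12 hcle hδle hδ0.le hc.le hsd hbd (le_max_right _ _) (le_max_left _ _) hF key

end Clauses

/-! ## §6 `B4.Ineq111_112` and `B4.Ineq19_110` on the nested-box family, with ONE pair of constants -/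

section Main

variable {ℓ : ℕ} {m2plus : ℝ}

/-- **B4's THEOREM p. 573, CLAUSES (1.11)–(1.12) — the cell's typed `B4.Ineq111_112` — AT `A = 0` ON THE NESTED-BOX
ZERO-FIELD FAMILY**, for every `0 ≤ α < 1` and every admissible boundary assignment `g`: constants `δ₀, c₀ > 0`
(depending on `d`, `L`, `a`, `m²₊`, `α` — «independent of A, k, Ω») such that for every `0 < δ ≤ δ₀`, `c ≥ c₀` (the
bound is monotone in the constants), EVERY threshold `R₀` and EVERY member `i`, `Ineq111_112 (nestFam … i) α δ c R₀`
holds (its antecedent `rect ∨ …` is not used: «for rectangular parallelepipeds … for all x, x′ ∈ Ω»).  Assembled from §5.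
[cite: Balaban1983RegularityDecay, Theorem p. 573 (1.11)–(1.12), case A = 0, Ω ⊂ Ω₀ boxes, 0 ≤ α < 1] -/
theorem ineq111_112_nestFam_mono (hℓ : 1 ≤ ℓ) (a : ℝ) (ha : 0 < a) (Mb : ℕ)
    {g : ∀ i : ZeroFieldInstance d, (↥i.R → ℝ) → ℝ}
    (hg : ∀ (i : ZeroFieldInstance d) (f : ↥i.R → ℝ),
      (outR i.R i.R₀).Nonempty → (supp f).Nonempty → g i f ≤ bdist i.n i.hsub f)
    (α : ℝ) (hα0 : 0 ≤ α) (hα1 : α < 1) :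
    ∃ δ₀ c₀ : ℝ, 0 < δ₀ ∧ 0 < c₀ ∧ ∀ (δ c : ℝ), 0 < δ → δ ≤ δ₀ → c₀ ≤ c → ∀ (R₀ : ℝ) (i : NestInst d ℓ m2plus),
      Ineq111_112 (nestFam ℓ m2plus a Mb g i) α δ c R₀ := by
  obtain ⟨δ₁, c₁, hδ₁, hc₁, h₁⟩ := dlhs19_bound (m2plus := m2plus) hℓ a ha hg α hα0 hα1
  obtain ⟨δ₂, c₂, hδ₂, hc₂, h₂⟩ := dvalDG_bound (m2plus := m2plus) hℓ a ha hg
  obtain ⟨δ₃, c₃, hδ₃, hc₃, h₃⟩ := dvalG_bound (m2plus := m2plus) hℓ a ha hg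
  refine ⟨min δ₁ (min δ₂ δ₃), max c₁ (max c₂ c₃), lt_min hδ₁ (lt_min hδ₂ hδ₃), lt_max_of_lt_left hc₁,
    fun δ c hδ0 hδle hcle R₀ i => (ineq111_112_bond_iff a Mb g i.toZF _ _ _ _).2
      ⟨fun μ f x x' _ => ?_, fun μ f x _ => ⟨?_, ?_⟩⟩⟩
  · exact h₁ δ c hδ0 (hδle.trans (min_le_left _ _)) ((le_max_left _ _).trans hcle) i μ f x x'
  · exact h₂ δ c hδ0 (hδle.trans ((min_le_right _ _).trans (min_le_left _ _)))
      (((le_max_left _ _).trans (le_max_right _ _)).trans hcle) i μ f x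
  · exact h₃ δ c hδ0 (hδle.trans ((min_le_right _ _).trans (min_le_right _ _)))
      (((le_max_right _ _).trans (le_max_right _ _)).trans hcle) i f x

/-- the same with the constants fixed: ONE pair `(δ₀, c₀)` for the whole family.
[cite: Balaban1983RegularityDecay, Theorem p. 573 (1.11)–(1.12), case A = 0, Ω ⊂ Ω₀ boxes, 0 ≤ α < 1] -/
theorem ineq111_112_nestFam (hℓ : 1 ≤ ℓ) (a : ℝ) (ha : 0 < a) (Mb : ℕ)
    {g : ∀ i : ZeroFieldInstance d, (↥i.R → ℝ) → ℝ}
    (hg : ∀ (i : ZeroFieldInstance d) (f : ↥i.R → ℝ),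
      (outR i.R i.R₀).Nonempty → (supp f).Nonempty → g i f ≤ bdist i.n i.hsub f)
    (α : ℝ) (hα0 : 0 ≤ α) (hα1 : α < 1) :
    ∃ δ₀ c₀ : ℝ, 0 < δ₀ ∧ 0 < c₀ ∧ ∀ (R₀ : ℝ) (i : NestInst d ℓ m2plus),
      Ineq111_112 (nestFam ℓ m2plus a Mb g i) α δ₀ c₀ R₀ := by
  obtain ⟨δ₀, c₀, hδ, hc, h⟩ := ineq111_112_nestFam_mono (m2plus := m2plus) hℓ a ha Mb hg α hα0 hα1
  exact ⟨δ₀, c₀, hδ, hc, h δ₀ c₀ hδ le_rfl le_rfl⟩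

/-- **THE TWO (1.10)·(1.12) CLAUSES ALSO HOLD VERBATIM IN b04's CARRIER** `zeroFieldSettingB` (identical fields
`dvalDG`, `dvalG`, `sdist1`, `bdist1`, `bdistS`, `supNorm`, `rect`): one pair `(δ₀, c₀)` (no `α`) such that for every
threshold `R₀`, member, direction, source and point the second conjunct of `Ineq111_112 (nestFamB … i) α δ₀ c₀ R₀` holds.
[cite: Balaban1983RegularityDecay, Theorem p. 573 (1.10)·(1.11)·(1.12), case A = 0, Ω ⊂ Ω₀ boxes] -/
theorem ineq112_nestFamB (hℓ : 1 ≤ ℓ) (a : ℝ) (ha : 0 < a) (Mb : ℕ)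
    {g : ∀ i : ZeroFieldInstance d, (↥i.R → ℝ) → ℝ}
    (hg : ∀ (i : ZeroFieldInstance d) (f : ↥i.R → ℝ),
      (outR i.R i.R₀).Nonempty → (supp f).Nonempty → g i f ≤ bdist i.n i.hsub f) :
    ∃ δ₀ c₀ : ℝ, 0 < δ₀ ∧ 0 < c₀ ∧ ∀ (R₀ : ℝ) (i : NestInst d ℓ m2plus)
      (μ : (nestFamB ℓ m2plus a Mb g i).Dir) (f : (nestFamB ℓ m2plus a Mb g i).Src)
      (x : (nestFamB ℓ m2plus a Mb g i).Site),
      ((nestFamB ℓ m2plus a Mb g i).rect ∨ R₀ ≤ (nestFamB ℓ m2plus a Mb g i).bdist1 x) →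
        (nestFamB ℓ m2plus a Mb g i).dvalDG μ f x ≤
            c₀ * Real.exp (-(δ₀ * (nestFamB ℓ m2plus a Mb g i).sdist1 x f)) *
              Real.exp (-(δ₀ * (nestFamB ℓ m2plus a Mb g i).bdist1 x
                + δ₀ * (nestFamB ℓ m2plus a Mb g i).bdistS f)) * (nestFamB ℓ m2plus a Mb g i).supNorm f ∧
          (nestFamB ℓ m2plus a Mb g i).dvalG f x ≤
            c₀ * Real.exp (-(δ₀ * (nestFamB ℓ m2plus a Mb g i).sdist1 x f)) *
              Real.exp (-(δ₀ * (nestFamB ℓ m2plus a Mb g i).bdist1 x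
                + δ₀ * (nestFamB ℓ m2plus a Mb g i).bdistS f)) * (nestFamB ℓ m2plus a Mb g i).supNorm f := by
  obtain ⟨δ₀, c₀, hδ, hc, h⟩ := ineq111_112_nestFam (m2plus := m2plus) hℓ a ha Mb hg 0 le_rfl one_pos
  exact ⟨δ₀, c₀, hδ, hc, fun R₀ i => ineq112_B_of_bond a Mb g i.toZF (h R₀ i)⟩

/-- (1.9)–(1.10) = `Ineq19_110` on the carrier is monotone in the constants. [folklore] -/
theorem ineq19_110_weaken (a : ℝ) (Mb : ℕ) (g : ∀ i : ZeroFieldInstance d, (↥i.R → ℝ) → ℝ)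
    (i : ZeroFieldInstance d) {α δ δ' c c' R₀ : ℝ} (hδ : δ' ≤ δ) (hc : c ≤ c') (hc0 : 0 ≤ c)
    (h : Ineq19_110 (zeroFieldSettingBond a Mb g i) α δ c R₀) :
    Ineq19_110 (zeroFieldSettingBond a Mb g i) α δ' c' R₀ := by
  rw [ineq19_110_bond_iff] at h ⊢
  obtain ⟨h1, h2⟩ := h
  exact ⟨fun μ f x x' hr => weaken hc hδ hc0 (setDist_edistR_nonneg _ _) (supN_nonneg i f) (h1 μ f x x' hr),
    fun μ f x hr => ⟨weaken hc hδ hc0 (setDist_edistR_nonneg _ _) (supN_nonneg i f) (h2 μ f x hr).1,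
      weaken hc hδ hc0 (setDist_edistR_nonneg _ _) (supN_nonneg i f) (h2 μ f x hr).2⟩⟩

/-- **(1.9)–(1.10) = `Ineq19_110` AT `A = 0` ON THE NESTED-BOX FAMILY** (every `0 ≤ α < 1`, one pair of constants):
each member IS a member of node 12's box family (`Ω₀` = the translated outer box), so this is
`B4Ineq19ZeroBoxEta.ineq19_110_boxFam`. [cite: Balaban1983RegularityDecay, Theorem p. 573 (1.9)–(1.10), case A = 0,
Ω a box, 0 ≤ α < 1] -/
theorem ineq19_110_nestFam (hℓ : 1 ≤ ℓ) (a : ℝ) (ha : 0 < a) (Mb : ℕ)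
    (g : ∀ i : ZeroFieldInstance d, (↥i.R → ℝ) → ℝ) (α : ℝ) (hα0 : 0 ≤ α) (hα1 : α < 1) :
    ∃ δ₀ c₀ : ℝ, 0 < δ₀ ∧ 0 < c₀ ∧ ∀ (R₀ : ℝ) (i : NestInst d ℓ m2plus),
      Ineq19_110 (nestFam ℓ m2plus a Mb g i) α δ₀ c₀ R₀ := by
  obtain ⟨δ₀, c₀, hδ, hc, h⟩ := ineq19_110_boxFam (m2plus := m2plus) hℓ a ha Mb g α hα0 hα1
  exact ⟨δ₀, c₀, hδ, hc, fun R₀ i => h R₀ i.toBox⟩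

/-- **B4's THEOREM p. 573 AT `A = 0` ON THE NESTED-BOX ZERO-FIELD FAMILY — BOTH CONJUNCTS OF THE TYPED LEAF WITH ONE
PAIR OF CONSTANTS**: for every `0 ≤ α < 1` and admissible `g` there are `δ₀, c₀ > 0` with
`∀ R₀ i, Ineq19_110 (nestFam … i) α δ₀ c₀ R₀ ∧ Ineq111_112 (nestFam … i) α δ₀ c₀ R₀`.
[cite: Balaban1983RegularityDecay, Theorem p. 573 (1.9)–(1.12), case A = 0, Ω ⊂ Ω₀ boxes, 0 ≤ α < 1] -/
theorem thm_nestFam (hℓ : 1 ≤ ℓ) (a : ℝ) (ha : 0 < a) (Mb : ℕ)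
    {g : ∀ i : ZeroFieldInstance d, (↥i.R → ℝ) → ℝ}
    (hg : ∀ (i : ZeroFieldInstance d) (f : ↥i.R → ℝ),
      (outR i.R i.R₀).Nonempty → (supp f).Nonempty → g i f ≤ bdist i.n i.hsub f)
    (α : ℝ) (hα0 : 0 ≤ α) (hα1 : α < 1) :
    ∃ δ₀ c₀ : ℝ, 0 < δ₀ ∧ 0 < c₀ ∧ ∀ (R₀ : ℝ) (i : NestInst d ℓ m2plus),
      Ineq19_110 (nestFam ℓ m2plus a Mb g i) α δ₀ c₀ R₀ ∧ Ineq111_112 (nestFam ℓ m2plus a Mb g i) α δ₀ c₀ R₀ := by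
  obtain ⟨δ₁, c₁, hδ₁, hc₁, h₁⟩ := ineq19_110_boxFam (m2plus := m2plus) hℓ a ha Mb g α hα0 hα1
  obtain ⟨δ₂, c₂, hδ₂, hc₂, h₂⟩ := ineq111_112_nestFam_mono (m2plus := m2plus) hℓ a ha Mb hg α hα0 hα1
  refine ⟨min δ₁ δ₂, max c₁ c₂, lt_min hδ₁ hδ₂, lt_max_of_lt_left hc₁, fun R₀ i => ⟨?_, ?_⟩⟩
  · exact ineq19_110_weaken a Mb g i.toZF (min_le_left _ _) (le_max_left _ _) hc₁.le (h₁ R₀ i.toBox)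
  · exact h₂ (min δ₁ δ₂) (max c₁ c₂) (lt_min hδ₁ hδ₂) (min_le_right _ _) (le_max_right _ _) R₀ i

end Main

/-! ## §7 The leaf shape: `B4.ThmPrinted` with `0 ≤ α < 1` (`ThmPrintedNN`), and it HOLDS on the nested-box family -/

section Leaf

variable {I : Type}

/-- **THE TYPED LEAF `B4.ThmPrinted` WITH THE HÖLDER EXPONENT RESTRICTED TO `0 ≤ α < 1`** (verbatim the leaf's
quantifier shape and BOTH conjuncts `Ineq19_110 ∧ Ineq111_112`; only the binder `0 ≤ α` is added — the typed leaf
quantifies `∀ α < 1`, whose `α < 0` instances are not the printed theorem's content, see `B4Ineq19ZeroBoxEta`,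
OBSERVATION (O-α)). [cite: Balaban1983RegularityDecay, Theorem p. 573 (1.9)–(1.12), transcription of the typed leaf
`B4.ThmPrinted` restricted to 0 ≤ α] -/
def ThmPrintedNN (fam : I → EtaSetting) : Prop :=
  ∀ α : ℝ, 0 ≤ α → α < 1 → ∃ δ₀ c₀ R₀ e₁ : ℝ, 0 < δ₀ ∧ 0 < c₀ ∧ 0 < R₀ ∧ 0 < e₁ ∧ ∀ i : I,
    (fam i).regular → (fam i).bigBlocks → 0 < (fam i).e → (fam i).e ≤ e₁ →
      Ineq19_110 (fam i) α δ₀ c₀ R₀ ∧ Ineq111_112 (fam i) α δ₀ c₀ R₀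

/-- the typed leaf implies its `0 ≤ α` restriction (so `ThmPrintedNN` IS a weakening of the cell's leaf, not a new
statement). [folklore] -/
theorem thmPrintedNN_of_thmPrinted (fam : I → EtaSetting) (h : ThmPrinted fam) : ThmPrintedNN fam :=
  fun α _ hα1 => h α hα1

/-- the restricted leaf implies node 12's (1.9)–(1.10) half `ThmPrinted19NN`. [folklore] -/
theorem thmPrinted19NN_of_thmPrintedNN (fam : I → EtaSetting) (h : ThmPrintedNN fam) : ThmPrinted19NN fam := by
  intro α hα0 hα1
  obtain ⟨δ₀, c₀, R₀, e₁, hδ, hc, hR, he, H⟩ := h α hα0 hα1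
  exact ⟨δ₀, c₀, R₀, e₁, hδ, hc, hR, he, fun i h1 h2 h3 h4 => (H i h1 h2 h3 h4).1⟩

variable {ℓ : ℕ} {m2plus : ℝ}

/-- **THE RESTRICTED LEAF `ThmPrintedNN` HOLDS ON THE NESTED-BOX ZERO-FIELD FAMILY** (every `L = ℓ + 1 ≥ 2`, `a > 0`,
mass window `[0, m²₊]`, big-block size `Mb`, ADMISSIBLE boundary assignment `g`): unconditionally in the member — the
typed antecedents `regular`, `bigBlocks`, `0 < e ≤ e₁` are not used, and `R₀`, `e₁` are witnessed by `1`.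
[cite: Balaban1983RegularityDecay, Theorem p. 573 (1.9)–(1.12), case A = 0, Ω ⊂ Ω₀ boxes, 0 ≤ α < 1] -/
theorem thmPrintedNN_nestFam (hℓ : 1 ≤ ℓ) (a : ℝ) (ha : 0 < a) (Mb : ℕ)
    {g : ∀ i : ZeroFieldInstance d, (↥i.R → ℝ) → ℝ}
    (hg : ∀ (i : ZeroFieldInstance d) (f : ↥i.R → ℝ),
      (outR i.R i.R₀).Nonempty → (supp f).Nonempty → g i f ≤ bdist i.n i.hsub f) :
    ThmPrintedNN (nestFam (d := d) ℓ m2plus a Mb g) := by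
  intro α hα0 hα1
  obtain ⟨δ₀, c₀, hδ, hc, h⟩ := thm_nestFam (m2plus := m2plus) hℓ a ha Mb hg α hα0 hα1
  exact ⟨δ₀, c₀, 1, 1, hδ, hc, one_pos, one_pos, fun i _ _ _ _ => h 1 i⟩

/-- the default boundary assignment `g = dist_η(supp f, Ω₀∖Ω)` (`B4Cor23ZeroDelta.bdist`, b04's `zeroFieldSetting`) is
admissible. [folklore] -/
theorem bdist_admissible :
    ∀ (i : ZeroFieldInstance d) (f : ↥i.R → ℝ), (outR i.R i.R₀).Nonempty → (supp f).Nonempty →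
      (fun (i : ZeroFieldInstance d) (f : ↥i.R → ℝ) => bdist i.n i.hsub f) i f ≤ bdist i.n i.hsub f :=
  fun _ _ _ _ => le_rfl

/-- **THE RESTRICTED LEAF ON THE DEFAULT NESTED-BOX FAMILY** (`bdistS = dist_η(supp f, Ω₀∖Ω)`, b04's
`zeroFieldSetting` re-read in the bond convention). [cite: Balaban1983RegularityDecay, Theorem p. 573 (1.9)–(1.12),
case A = 0, Ω ⊂ Ω₀ boxes, 0 ≤ α < 1] -/
theorem thmPrintedNN_nestFam_std (hℓ : 1 ≤ ℓ) (a : ℝ) (ha : 0 < a) (Mb : ℕ) :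
    ThmPrintedNN (fun i : NestInst d ℓ m2plus => zeroFieldSettingBondStd a Mb i.toZF) :=
  thmPrintedNN_nestFam hℓ a ha Mb bdist_admissible

end Leaf

/-! ## §8 Non-vacuity: a genuinely nested member meets the typed antecedents at every scale; instantiation -/

section NonVacuity

variable {ℓ : ℕ} {m2plus : ℝ}

/-- the member «scale `k`, inner box = ONE big block `[0, Mb)^{d+1}`, outer box `[−Mb, 2Mb)^{d+1}` (three big blocks
per direction, the inner one in the middle), mass `0`, charge `e`» — a genuinely nested pair `Ω ⊊ Ω₀`. [folklore] -/
def NestInst.nested (ℓ : ℕ) {m2plus : ℝ} (hm2 : 0 ≤ m2plus) (k : ℕ) (hk : 1 ≤ k) (Mb : ℕ) (hMb : 1 ≤ Mb) (e : ℝ) :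
    NestInst d ℓ m2plus where
  k := k
  hk := hk
  M := fun _ => Mb
  M0 := fun _ => 3 * Mb
  s := fun _ => (Mb : ℤ)
  hs := fun _ => ⟨by positivity, by push_cast; nlinarith⟩
  hM := fun _ => hMb
  m2 := 0
  hm := le_rfl
  hm' := hm2
  e := e

/-- NON-VACUITY AT EVERY SCALE: for every `e₁ > 0`, every big-block size `Mb ≥ 1` and every `k ≥ 1` the genuinely
nested member `nested … k … Mb … e₁` meets ALL FOUR typed antecedents of the leaf (`regular`; `bigBlocks`: both `Ω` and
the translated `Ω₀` are unions of `Mb·L^k`-blocks of fine points; `0 < e ≤ e₁`), so the threshold «for e sufficiently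
small» and the big-block hypothesis exclude no mesh `η = L^{-k}`. [folklore] -/
theorem nested_hypotheses (hm2 : 0 ≤ m2plus) (a : ℝ) (g : ∀ i : ZeroFieldInstance d, (↥i.R → ℝ) → ℝ) (k : ℕ)
    (hk : 1 ≤ k) (Mb : ℕ) (hMb : 1 ≤ Mb) {e₁ : ℝ} (he : 0 < e₁) :
    (nestFam ℓ m2plus a Mb g (NestInst.nested ℓ hm2 k hk Mb hMb e₁)).regular ∧
      (nestFam ℓ m2plus a Mb g (NestInst.nested ℓ hm2 k hk Mb hMb e₁)).bigBlocks ∧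
      0 < (nestFam ℓ m2plus a Mb g (NestInst.nested ℓ hm2 k hk Mb hMb e₁)).e ∧
      (nestFam ℓ m2plus a Mb g (NestInst.nested ℓ hm2 k hk Mb hMb e₁)).e ≤ e₁ := by
  have hMn : 1 ≤ Mb * (ℓ + 1) ^ k :=
    Nat.one_le_iff_ne_zero.mpr (Nat.mul_ne_zero (by omega) (Nat.pos_iff_ne_zero.mp (Nat.pos_of_ne_zero (by positivity))))
  have h1 : IsBlockUnion (Mb * (ℓ + 1) ^ k) (boxDom fun _ : Fin (d + 1) => (ℓ + 1) ^ k * Mb) :=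
    boxDom_isBlockUnion_of_dvd hMn fun _ => ⟨1, by ring⟩
  have h2 : IsBlockUnion (Mb * (ℓ + 1) ^ k) (shiftBox ((ℓ + 1) ^ k) (fun _ : Fin (d + 1) => 3 * Mb) fun _ => (Mb : ℤ)) :=
    shiftBox_isBlockUnion_of_dvd hMn (fun _ => ⟨3, by ring⟩) (fun _ => ⟨1, by push_cast; ring⟩)
  exact ⟨trivial, ⟨h1, h2⟩, he, le_rfl⟩

/-- hence, for every threshold `e₁ > 0` and every scale, SOME genuinely nested member meets the antecedents.
[folklore] -/
theorem threshold_met (hm2 : 0 ≤ m2plus) (a : ℝ) (g : ∀ i : ZeroFieldInstance d, (↥i.R → ℝ) → ℝ) {Mb : ℕ}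
    (hMb : 1 ≤ Mb) (k : ℕ) (hk : 1 ≤ k) {e₁ : ℝ} (he : 0 < e₁) :
    ∃ i : NestInst d ℓ m2plus, i.k = k ∧ (nestFam ℓ m2plus a Mb g i).regular ∧
      (nestFam ℓ m2plus a Mb g i).bigBlocks ∧ 0 < (nestFam ℓ m2plus a Mb g i).e ∧
      (nestFam ℓ m2plus a Mb g i).e ≤ e₁ :=
  ⟨NestInst.nested ℓ hm2 k hk Mb hMb e₁, rfl, nested_hypotheses hm2 a g k hk Mb hMb he⟩

/-- the outer region of the nested member is strictly larger: the fine point `−1` (all coordinates) lies in `Ω₀∖Ω`.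
[folklore] -/
theorem nested_outR_nonempty (hm2 : 0 ≤ m2plus) (k : ℕ) (hk : 1 ≤ k) (Mb : ℕ) (hMb : 1 ≤ Mb) (e : ℝ) :
    (outR (NestInst.nested (d := d) ℓ hm2 k hk Mb hMb e).toZF.R
      (NestInst.nested (d := d) ℓ hm2 k hk Mb hMb e).toZF.R₀).Nonempty := by
  have hL : 1 ≤ (ℓ + 1) ^ k := BoxInst.one_le_Lk ℓ k
  have hmem : (fun _ : Fin (d + 1) => (-1 : ℤ)) ∈ shiftBox ((ℓ + 1) ^ k) (fun _ : Fin (d + 1) => 3 * Mb)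
      (fun _ => (Mb : ℤ)) := by
    rw [mem_shiftBox, mem_boxDom]
    intro j
    simp only [Pi.add_apply]
    have h1 : (1 : ℤ) ≤ ((ℓ + 1) ^ k : ℕ) := by exact_mod_cast hL
    have h2 : (1 : ℤ) ≤ (Mb : ℕ) := by exact_mod_cast hMb
    push_cast at h1 h2 ⊢
    constructor <;> nlinarith
  refine ⟨⟨_, hmem⟩, mem_outR.2 ?_⟩
  show (fun _ : Fin (d + 1) => (-1 : ℤ)) ∉ boxDom (fun _ : Fin (d + 1) => (ℓ + 1) ^ k * Mb)
  rw [mem_boxDom]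
  intro h
  have h0 := (h 0).1
  norm_num at h0

/-- the index type is inhabited: `d + 1 = 4`, `L = 2`, `m²₊ = 1`, scale `k = 3` (`η = 1/8`), big blocks of size `5`,
charge `1`. [folklore] -/
example : NestInst 3 1 1 := NestInst.nested 1 zero_le_one 3 (by norm_num) 5 (by norm_num) 1

/-- the certified statement instantiated: `d + 1 = 4`, `L = 2`, `a = 1`, `m²₊ = 1`, `Mb = 5`, default `g`, `α = 1/2` —
BOTH conjuncts of the typed leaf with one pair of constants, for every threshold and member. [folklore] -/
example : ∃ δ₀ c₀ : ℝ, 0 < δ₀ ∧ 0 < c₀ ∧ ∀ (R₀ : ℝ) (i : NestInst 3 1 1),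
    Ineq19_110 (nestFam 1 1 1 5 (fun i f => bdist i.n i.hsub f) i) (1 / 2) δ₀ c₀ R₀ ∧
      Ineq111_112 (nestFam 1 1 1 5 (fun i f => bdist i.n i.hsub f) i) (1 / 2) δ₀ c₀ R₀ :=
  thm_nestFam le_rfl 1 one_pos 5 bdist_admissible (1 / 2) (by norm_num) (by norm_num)

/-- the restricted leaf on the default nested-box family at `d + 1 = 4`, `L = 2`, `a = 1`, `m²₊ = 1`, `Mb = 5`.
[folklore] -/
example : ThmPrintedNN (fun i : NestInst 3 1 1 => zeroFieldSettingBondStd 1 5 i.toZF) :=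
  thmPrintedNN_nestFam_std le_rfl 1 one_pos 5

end NonVacuity

end

end Literature.MathematicalPhysics.QuantumFieldTheory.Balaban1983to89.B4Ineq111ZeroNestEta
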